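import Mathlib
import Literature.MathematicalPhysics.QuantumFieldTheory.Balaban1983to89.DagDischarged
import Literature.MathematicalPhysics.QuantumFieldTheory.Balaban1983to89.B4Prop23ZeroRegion
import Literature.MathematicalPhysics.QuantumFieldTheory.Balaban1983to89.B8Lemma1NonAbelian
import Literature.MathematicalPhysics.QuantumFieldTheory.Balaban1983to89.B7Prop1Local
import Literature.MathematicalPhysics.QuantumFieldTheory.Balaban1983to89.B4Ineq111ZeroNestEta
import Literature.MathematicalPhysics.QuantumFieldTheory.Balaban1983to89.B4Thm19ZeroBoxNegAlpha
import Literature.MathematicalPhysics.QuantumFieldTheory.Balaban1983to89.B4Ineq112ZeroNestNegFace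

/-!
# `Balaban1983to89.DagDischargedII` — kernel discharges of DAG-leaf conjuncts, recorded against the typed binding (continuation ledger), v6

CITATION HEADER (lean-in-tree rule 2026-08-18; audit cell `pub-balaban`, CARVER seat).  `…Balaban1983to89.Dag` (v4.2)
states the citation DAG of T. Bałaban's lattice Yang–Mills ultraviolet-stability series [Balaban1983RegularityDecay]–
[Balaban1989LargeFieldII] over ABSTRACT leaves; `…Balaban1983to89.DagBinding` (v10.2) binds those leaves to the typed
statements of the per-paper modules (`Upstream.ofPrinted`, …, `Upstream.ofPrintedAllXP`); `…Balaban1983to89.DagDischarged`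
(v12) is the ledger of what the kernel has DISCHARGED inside those leaf types — twelve additive sections, one per
concrete carrier family for which a sub-cell of the cell PROVED a leaf conjunct AS TYPED.  That file has reached the
lineage's byte cap (200 000 B; v12 = 197 592 B), so THIS module CONTINUES the same ledger under the same rules: it is
ADDITIVE and READING-NEUTRAL (a leaf keeps its TYPE — a conjunction of verbatim printed statements used as
hypotheses — whatever is later proved about it), it imports `…DagDischarged` (hence `…Dag`, `…DagBinding` and every
module the first ledger cites) plus, per section, the ONE standalone module whose theorem it records BY NAME, and it
is itself a STANDALONE LEAF of the import graph (imported by no module other than a package index; `…DagDischarged`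
is from now on imported by this module only).  Nothing in `…Dag`, `…DagBinding` or `…DagDischarged` is edited.
v2 (cell mirror pass 49) is ADDITIVE: one new import (`…B8Lemma1NonAbelian`), the second bullet and the section
«Leaf `b8`, conjunct `l1` — … NON-ABELIAN block-pair carriers» below; statement and proof of every v1 declaration
byte-identical.
v3 (cell mirror pass 51) is ADDITIVE: one new import (`…B7Prop1Local`, which brings `…B7Prop2SpecialUnitary`;
`…B7Prop1Explicit` and `…B7Prop2Explicit` were already imported through `…B8Lemma1NonAbelian`), the third bullet
and the section «Leaf `b7`, conjuncts `p1` ∧ `p2` — … CONCRETE block averages» below; statement and proof of every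
v2 declaration byte-identical.
v4 (cell mirror pass 57) is ADDITIVE: two new imports (`…B4Ineq111ZeroNestEta`, node 13, and
`…B4Thm19ZeroBoxNegAlpha`, node 16, of the pv17 lineage — both standalone B4 modules importing no `Dag…` file), the
fourth bullet and the section «Leaf `b4`, conjunct 1 — … REFUTED AS TYPED … DISCHARGED on the zero-field nested-box
family» below; statement and proof of every v3 declaration byte-identical.
v5 (cell mirror pass 59) is ADDITIVE: one new import (`…B4Ineq112ZeroNestNegFace`, node 17 of the pv17 lineage —
standalone, importing nodes 13 ∕ 16 only), the fifth bullet, one records line under the fourth bullet, and the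
section «Leaf `b4`, conjunct 1 in its `0 ≤ α` restriction — the NEGATIVE EDGE on b04's VERBATIM … carriers» below;
statement and proof of every v4 declaration byte-identical.
v6 (cell mirror pass 72) is ADDITIVE: NO new import, the sixth bullet and the section «Leaf `b4`, conjunct 1 — the
REFEREE's RULING G-ref1-32 …» below (the cell referee's ruling on the faithful reading of conjunct 1, recorded against
the carriers v4 ∕ v5 already bind); statement and proof of every v5 declaration byte-identical.

* **v1 — Leaf `b4`, conjunct 2, «Proposition 2.3 of [1]» (1.15)–(1.20) p. 574, for the zero-field NESTED-REGION
  carriers (general finite unions of `L`-blocks `Ω ⊂ Ω₀`), `A = 0`.**  [Balaban1983RegularityDecay] p. 572: «We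
  consider subsets Ω which are unions of big blocks»; p. 574, Proposition 2.3: «for arbitrary Λ ⊂ Ω^{(k)} = Ω∩Z^d»,
  «for Ω ⊂ Ω₀».  `…DagDischarged` v10 recorded the kernel proof of this conjunct for the zero-field NESTED-BOX family
  (`B4Prop23ZeroBox.zeroFieldBoxes`, pv17 lineage) and v11 for the zero-field WHOLE-TORUS family
  (`B4Ineq118Torus.torusFam`, pv07 lineage).  The pv17 lineage's standalone module `…B4Prop23ZeroRegion` (cell GAPS
  C-pv17g9 ∕ certification C-pv24g8-6; it imports `…B4TwoRegion120` and `…B4Prop23ZeroBox` only, no `Dag…` file)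
  PROVES it, hypothesis-free, for a THIRD and a FOURTH concrete family — all zero-field (`A = 0`) instances on NESTED
  FINITE UNIONS `Ω ⊂ Ω₀` OF `L`-BLOCKS OF UNIT SITES of any shape (index type `B4Prop23ZeroRegion.ZeroRegionIdx d ℓ a₋
  a₊ m²₊ a₂₋ a₂₊`: mesh `n ≥ 1`, running constants in the window, `Ω ⊆ Ω₀` both `IsBlockUnion (ℓ+1)`, every finite
  `Λ ⊆ Ω^{(k)}`, charge `e`): `B4Prop23ZeroRegion.prop23Printed_zeroFieldRegions d ℓ (hℓ : 1 ≤ ℓ) (ha : 0 < a₋)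
  (ha2 : 0 < a₂₋)` for the carriers `zeroFieldRegions` (complements `Λ^c`, `Ω^{(k)c}` of (1.18), (1.20) read INSIDE
  `Ω^{(k)}` resp. as `Ω₀^{(k)} ∖ Ω^{(k)}`, where the operators live) and `…prop23Printed_zeroFieldRegionsLit` for the
  carriers `zeroFieldRegionsLit` (the same complements read LITERALLY in the unit lattice `Z^d`; the literal weights
  are the smaller ones, the degenerate cases `Λ = Ω^{(k)}`, `Ω = Ω₀` handled by the vanishing of the differences).
  This section records both discharges BY NAME against the current P-binding, in the pattern of v10 ∕ v11: for binding
  carriers whose B4 unit-lattice family IS one of these families (`PrintedCarriersR.withZeroFieldRegions`,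
  `PrintedCarriersR.withZeroFieldRegionsLit`), the `b4` field is EQUIVALENT to Theorem p. 573 (`B4.ThmPrinted`) and
  «Prop. 3.1′ of [2]» (`B4.Prop31Printed`); combined with v9 (`B4Prop31Zero.zeroFieldForms` for `famF`), the `b4` field
  is EQUIVALENT to Theorem p. 573 ALONE.  READING NOTE (cell REFEREE R44; honest scope = `…B4Prop23ZeroRegion` HONEST
  SCOPE (i)–(vii), carried verbatim in substance): (i) `A = 0` ONLY (`U ≡ 1`) — the content of «for e sufficiently
  small» and of the regularity condition (1.7), i.e. the whole difficulty of B4 §§2–4 for `A ≠ 0`, is absent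
  (`regular := True`, the `e`-binders met with `e₁ = 1` and unused); (ii) the regions are nested FINITE unions of
  `L`-blocks of unit sites — nothing for infinite regions; (iii) «Λ being a sum of big blocks» is NOT imposed
  (`bigBlocks := True`; the certificates hold for every finite `Λ ⊆ Ω^{(k)}` — formally stronger there, weaker in (i));
  (iv) the constants are existential, depend on `d`, `ℓ` AND the window (print: «dependent on d and M only»), no
  numerical value claimed; (v) sup norm instead of the Euclidean norm in the exponents; (vi) the proofs of
  (1.15)–(1.20) at `A = 0` are the lineage's (`B4RegionCov1518`, `B4TwoRegion120`).  The abstract hypothesis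
  `B4.Prop23Printed X.famU` for an ARBITRARY `famU` is NOT discharged; `…DagBinding` is not changed.

* **v2 — Leaf `b8`, conjunct `l1`, Lemma 1 (1.24) ⇒ (1.25) pp. 79–80 of [Balaban1985RegularSpaces], for the
  NON-ABELIAN block-pair carriers.**  `…DagDischarged` v8 recorded the kernel proof of this conjunct
  (`l1 : B8.Lemma1Printed d loc` of the faithful leaf `DagBinding.B8LeafR`) for the block-pair carriers
  `B8Lemma1Lattice.blockPair d L` of the cell's ABELIAN (additive) model, with the honest scope «abelian model only
  (the non-abelian `R(·)`-transports and BCH remainders of the `G`-valued statement are not formalised)».  The b08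
  lineage's standalone module `…B8Lemma1NonAbelian` (cell GAPS C-B8-41, DIVERGENCE D-b08-g17.1; it imports
  `…B7Prop1Explicit`, `…B7Prop2Explicit`, `…B8`, `…B8Lemma1Lattice` only, no `Dag…` file) now PROVES it,
  hypothesis-free, in the GENUINELY NON-COMMUTATIVE setting: `B8Lemma1NonAbelian.lemma1Printed_blockPairNA (d L : ℕ)
  (𝔸 : Type) [NormedRing 𝔸] [NormOneClass 𝔸] [NormedAlgebra ℂ 𝔸] [CompleteSpace 𝔸] : B8.Lemma1Printed d
  (blockPairNA d L 𝔸)` for the carriers `blockPairNA d L 𝔸 : Site d × Fin d → B8.LocalData` — one `LocalData` per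
  coarse bond `c = ⟨y, y + L e_κ⟩` of the corner lattice of `ℤ^d` (the index type of `blockPair`), configurations ∕
  perturbations = `G`-valued bond fields `Site d → Fin d → 𝔸ˣ` with `G = U1 𝔸` (the units `u` with `‖u‖, ‖u⁻¹‖ ≤ 1`
  of a complete normed `ℂ`-algebra with `‖1‖ = 1`; the printed `G ⊂ U(N) ⊂ M_N(ℂ)` with the operator norm, or the
  unitary group of any C⋆-algebra, is `U1`-valued: `B7Prop2Explicit.unitaryUnits_le_U1`, whence the module's
  `lemma1_unitary`), `small` = `U1`-valued ∧ (1.7)`_{k=1}` (strict) for `V₀` and `V′V₀` on `B(c₋) ∪ B(c₊)`,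
  `axialClose` = (1.24) (strict) with the average (42) `bavg` of [Balaban1985Averaging] as typed in
  `…B7Prop1Explicit`, `pertDev` = `sup ‖V′_b − 1‖` over the bonds of `B(c₋) ∪ B(c₊)`; smallness constant
  `c = 1/(6(d+1))`.  This section records that discharge BY NAME against the current P-binding, in exactly the v8
  pattern of `…DagDischarged`: for binding carriers whose B8 Lemma-1 data are that family
  (`PrintedCarriersR.withBlockPairNA`), the `b8` field is EQUIVALENT to the faithful leaf WITHOUT its `l1` conjunct
  (`DagDischarged.B8LeafRest`: Thm 2, Prop 3, Thm 4, Prop 5 (both halves), Prop 6, Prop 7 (repaired reading), Thm 8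
  (at γ = 1) — all QUOTED, unchanged), at the P-binding and at the K-binding of v3, every κ; Theorem 8 at γ = 1 (what
  B9 consumes) comes from the quoted rest alone; and conjunct `l1` is now a theorem of the package for TWO concrete
  carrier families (abelian `blockPair`, non-abelian `blockPairNA`), the instance `𝔸 = ℂ` included as the simplest
  inhabitant of the typeclass package.  READING NOTE (honest scope = `…B8Lemma1NonAbelian` HONEST SCOPE (i)–(vi),
  carried verbatim in substance): (i) model `U1 𝔸`-valued fields — for `M_N(ℂ)` with the operator norm and
  `G ⊂ U(N)` this is the printed setting; the series `log` of (42) needs `‖W − 1‖ < 1`, guaranteed there by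
  `ω ≤ 1/6`; (ii) «for α₀, α₁ small» is made explicit as `α₀, α₁ ≤ 1/(6(d+1))`, no optimality claimed; (iii) only
  the `j = 1` clause of (1.7) is used and only for plaquettes inside `B(c₋) ∪ B(c₊)`, (1.24) only on `B(c₋) ∪ B(c₊)`
  and at the one coarse bond `c` — the locality sentence of p. 80, there a theorem; (iv) corner-anchored blocks,
  `d`-first trees, positively oriented `c` (the conventions of `…B7Prop1Explicit` ∕ `…B8Lemma1Lattice`); (v) the core
  theorems take `≤`-hypotheses, the carriers the printed strict `<`; (vi) the PROOF ROUTE is the module's own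
  (gauge-invariant, through the loops `W_{c,x}` of the average and one algebraic factorisation per crossing bond,
  landing inside the printed constant `4d²α₀ + α₁`), NOT the printed chain of covariant differences, whose literal
  completion exceeds `4d²` for `d ≥ 2` (cell census G-B8-10) — what is certified is the printed STATEMENT
  (1.24) ⇒ (1.25) with the printed constant and the printed locality.  As in v8, the leaf's real block-size
  parameter `L8` (entering Prop 3 ∕ Prop 6) is not tied by the typing to the natural block size `Lb` of the `l1`
  carriers, which are discharged at EVERY `Lb : ℕ` (`Lb = 0`: empty region; `d = 0`: no index); the abstract node
  `B8.Lemma1Printed d loc` for ARBITRARY `loc` is NOT claimed; `…DagBinding` and `…DagDischarged` are not changed.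

* **v3 — Leaf `b7`, conjuncts `p1` ∧ `p2`, Proposition 1 (51) and Proposition 2 (52)–(54) p. 26 of
  [Balaban1985Averaging], for the CONCRETE block averages (42) ∕ (43) on `ℤ^d`.**  p. 26: «There exist positive
  constants C₀, c′₂ such that for every configuration V satisfying (44) for p ⊂ Δ(p′) and for α₀ ≤ c′₂, we have
  |V̄(∂p′) − 1| < L²α₀ + C₀(L²α₀)² (51).  The constant C₀ depends on d and c′₂ depends on d and L.»; «If U satisfies
  (52) with α₀ ≤ c₂ = min{1/(3C₀), ½c′₂}, then |Ū^k(∂p) − 1| < α₀ + 2C₀α₀² < 2α₀, p ⊂ Ω^{(k)} (54).»  Leaf `b7` of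
  every binding is `B7.Concl X.L7 X.c₂ X.C₀ X.c₂' X.one7 X.kst7 X.kexp7 X.gd7 X.gone7` — the record of the ten
  printed Propositions of the paper over ABSTRACT carriers; no section of either ledger touched it so far.  The b07
  lineage's standalone modules (none of which imports a `Dag…` file) PROVE its first two fields, hypothesis-free, for
  CONCRETE carriers realising (42) ∕ (43): `B7Prop1Explicit.prop1Printed_concrete (L : ℕ) (hL : 1 ≤ L) :
  B7.Prop1Printed (L : ℝ) (concreteOneStep 𝔸 L)` (cell GAPS C-b07g13-1, DIVERGENCE D-b07g13.1; index = the
  plaquettes `p′` of the `L`-lattice of `ℤ^d`, configurations `Site d → Fin d → 𝔸ˣ` with values in `U1 𝔸`, `𝔸` any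
  complete normed `ℂ`-algebra with `‖1‖ = 1`, `plaqDev` = the supremum of `|V(∂p) − 1|` over ALL unit plaquettes,
  `avgDev = |V̄(∂p′) − 1|` for the average (42)); `B7Prop2Explicit.prop2Printed_concrete (L : ℕ) (hL : 2 ≤ L)
  (hG : AvgClosed d L G) : B7.Prop2Printed (C0 d) (c2' d L) (fun k : ℕ => concreteKStep d 𝔸 G L k)` (C-b07g14-1,
  D-b07g14.1; `G`-valued configurations for any `AvgClosed` subgroup `G ≤ 𝔸ˣ` — certified instances the unitary
  group of a non-trivial C⋆-algebra, in particular the printed `U(N) ⊂ M_N(ℂ)` with the operator norm (19),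
  `prop2Printed_unitaryGroup`; (52) over all plaquettes); and — WITH THE PRINTED LOCALITY («(44) for p ⊂ Δ(p′)»
  (46); «enough to assume (52) for p ⊂ B^k(x) ∪ B^k(y) ∪ B^k(z) ∪ B^k(w)» p. 26) —
  `B7Prop1Local.prop1Printed_concrete_local … : B7.Prop1Printed (L : ℝ) (concreteOneStepLocal 𝔸 L)` and
  `B7Prop1Local.prop2Printed_concrete_local … : B7.Prop2Printed (C0 d) (c2' d L) (concreteKStepLocal d 𝔸 G L)`
  (C-b07g15-2, D-b07g15.2); all with the WITNESSES `C₀ = 14464(d+1)²(d+4)²`, `c₂′ = 1/(512(d+1)(d+4)L²)` and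
  `c₂ = min{1/(3C₀), ½c₂′}` exactly as printed.  This section records those discharges BY NAME against the current
  P-binding, in the v8 ∕ II-v2 pattern: for binding carriers whose B7 averaging data ARE one of these carrier pairs
  and whose `L7`, `C₀`, `c₂'` are `L`, `C0 d`, `c2' d L` (`PrintedCarriersR.withConcreteAvg`,
  `PrintedCarriersR.withConcreteAvgLocal`; `c₂` and the Prop. 3–10 carriers `kexp7`, `gd7`, `gone7` unchanged), the
  `b7` field is EQUIVALENT to the leaf WITHOUT its `p1`, `p2` conjuncts (`B7LeafRest`: Props. 3–10 as typed — all
  QUOTED, unchanged), at the P-binding and at the K-binding, every κ, for every `d`, every `L ≥ 2`, every `𝔸`, every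
  `AvgClosed G` (the printed `U(N)` included, `prop2Printed_unitaryGroup_two_regions`).  READING NOTE (honest scope =
  the three modules' DIVERGENCES D-b07g13.1 (a)–(e), D-b07g14.1 (a)–(f), D-b07g15.2 (a)–(e), carried verbatim in
  substance): (i) SETTING `ℤ^d` (print: a torus or the whole space, p. 18; Props. 1–2 are local — with the printed
  locality only the torus bookkeeping of blocks wrapping around is not written); `G = U(N)` generalised to
  `U1 𝔸`-valued (Prop. 1) ∕ `AvgClosed`-subgroup-valued (Prop. 2) configurations — `U(N)` an instance; a proper Lie
  subgroup such as `SU(N)` only through `…B7Prop2SpecialUnitary` (threshold `c₂′(d, L, t_N)`), not bound here;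
  (ii) HYPOTHESIS REGION: the `…Explicit` pair assumes (44) ∕ (52) on ALL plaquettes (formally stronger hypotheses
  than printed, hence formally weaker certified statements), the `…Local` pair exactly the printed regions, blocks
  read as site sets (the reading with the fewest plaquettes, implying the other); (iii) `L ≥ 1` (Prop. 1), `L ≥ 2`
  (Prop. 2; print «L > 1» p. 17), `k = 0` allowed, `d` arbitrary (`μ ≠ ν` forces `d ≥ 2`), `≤`-cores with the
  printed strict `<` on the leaves; (iv) CONSTANTS admissible, not optimal (print: unspecified); `log` = the series
  (21); (v) the carriers' `L7 := L` ties the `L` of Props. 1, 3, 9 to the averaging block size, as in print.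
  VACUITY CAVEAT (cell node B7-PROP3-FLAT, b07 lineage): the concrete ONE-STEP carriers carry TRIVIAL Prop. 3 fields
  (`Fld := Unit`, `fldNorm := 0`, `IsAnalyticQ := True`, `remC := 0` — the modules treat Props. 1–2 only), so over
  them the quoted conjunct `B7.Prop3Printed L c₂ one7` holds for every `c₂ > 0` by `0 ≤ 0`
  (`prop3Printed_concreteOneStep_vacuous`) and carries NO content — this is NOT Proposition 3 of the paper
  (analyticity of `Q(V₀, A)` and (122)–(123) p. 36), whose genuine carrier is the (121)–(123) data at CURVED
  backgrounds `V₀` — in the tree so far only the flat-background rung `V₀ = 1` for the concrete average (42),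
  `…B7Prop3Flat` (b07 lineage; a first rung, not a carrier of the leaf's `one7`, not bound here); accordingly `ofPrintedAllXP_withConcreteAvgLocal_b7_iff_props4to10` displays the leaf over these carriers as
  EQUIVALENT to Propositions 4–10 (quoted, with content).  The abstract nodes `B7.Prop1Printed L one`,
  `B7.Prop2Printed C₀ c₂' kst` for ARBITRARY carriers, and Propositions 3–10, are NOT claimed; `…DagBinding` and
  `…DagDischarged` are not changed.

* **v4 — Leaf `b4`, conjunct 1, the Theorem p. 573 (1.9)–(1.12) of [Balaban1983RegularityDecay]: the typed
  transcription REFUTED AS TYPED on the zero-field carriers, its `0 ≤ α` restriction bound and discharged on the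
  zero-field nested-box family.**  p. 573: «Theorem (Proposition 2.1 of [1]). For α<1 there exist positive constants
  δ₀, c₀, R₀ independent of A, k, Ω and depending on d, M only, c₀ on α also, such that for e sufficiently small and
  for an arbitrary function f: Ω→R^N, we have … (1.9)»; p. 577: «We will need Hölder norms: … (2.14)».  Leaf `b4` of
  every binding `Upstream.ofPrinted … ofPrintedAllXP` is `B4.LeafB4 X.famE X.famU X.famF X.d4 X.N4`, whose FIRST
  conjunct `B4.ThmPrinted X.famE` transcribes the Theorem with the LITERAL quantifier `∀ α : ℝ, α < 1 →` over the
  exponent of the Hölder quotient of (1.9) ∕ (1.11) — no lower bound.  The pv17 lineage's node 16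
  `…B4Thm19ZeroBoxNegAlpha` (standalone; imports no `Dag…` file) PROVES that for EVERY `α < 0` that clause has NO
  constants on b04's own zero-field carriers — `not_thmPrinted_boxFamB (hℓ : 1 ≤ ℓ) (hm2 : 0 ≤ m2plus) (ha : 0 < a)
  (hMb : 1 ≤ Mb) (g) : ¬ ThmPrinted (boxFamB ℓ m2plus a Mb g)` over the box instances `B4Ineq19ZeroBoxEta.BoxInst d ℓ
  m²₊` and `not_thmPrinted_zeroFieldSettingB (ha : 0 < a) (hMb : 1 ≤ Mb) (g) : ¬ ThmPrinted (zeroFieldSettingB a Mb g)`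
  over b04's own index `B4Cor23ZeroEta.ZeroFieldInstance d` (cell GAPS C-pv17-69, DIVERGENCE D-pv17.29; witness: the
  cube Ω = Ω₀ = [0, M_b·N)^{d+1}, k = 1, m² = 0, source f := (−Δ + aP_k)·1_{y_μ = n−1} so that G_k(Ω,0)f is that
  indicator exactly — with a negative exponent the Hölder quotient GROWS like (M_b·N − 2)^{∣α∣} while the right side
  of (1.9) stays bounded; the typed antecedents `regular`, `bigBlocks`, `0 < e ≤ e₁` are met, `bigCube_hypotheses`).
  This is a TYPING DEFECT of the transcription — the print's «α» is the exponent of a Hölder norm, range `0 ≤ α < 1` —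
  and NOT a claim against the paper: on `0 ≤ α < 1` the same lineage proves the clauses at `A = 0` (nodes 12 ∕ 14:
  (1.9)–(1.10) on boxes; node 13 `…B4Ineq111ZeroNestEta`: BOTH conjuncts on the zero-field NESTED-BOX family,
  `thmPrintedNN_nestFam_std (hℓ : 1 ≤ ℓ) (a) (ha : 0 < a) (Mb) : ThmPrintedNN (fun i : NestInst d ℓ m2plus =>
  zeroFieldSettingBondStd a Mb i.toZF)`, antecedents met at every scale, `threshold_met`; cell GAPS C-pv14-89).  This
  section imports nodes 13 and 16 and records, additively and exactly as `…DagBinding` §(v8b) met the refuted literal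
  constant of [Balaban1984PropagatorsII] Lemma 2.1: (i) the NEGATIVE EDGE BY NAME — `not_leafB4_boxFamB`,
  `not_leafB4_zeroFieldSettingB`, and at binding level, over carriers `PrintedCarriersR.withBoxFamE` ∕
  `….withZeroFieldFamE` whose η-family IS one of those zero-field carriers, `not_ofPrintedAllXP_withBoxFamE_b4`,
  `not_ofPrintedAllXP_withZeroFieldFamE_b4`, `not_ofPrintedR_withBoxFamE_b4`: the TYPED `b4` leaf is FALSE there and
  every ledger implication routed through `(…).b4` is vacuous on such carriers; (ii) the leaf with conjunct 1 in its
  `0 ≤ α` restriction, `B4LeafNN famE famU famF d N := B4Ineq111ZeroNestEta.ThmPrintedNN famE ∧ B4.Prop23Printed famU ∧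
  B4.Prop31Printed famF ∧ B4.Sect5ThmUniform d N` (node 13's statement USED BY NAME, not restated; the other three
  conjuncts verbatim those of `B4.LeafB4`), the Prop-generic plumbing `Upstream.withB4` and the re-bound upstream
  `Upstream.ofPrintedAllXPN X Y Z V W := (Upstream.ofPrintedAllXP X Y Z V W).withB4 (B4LeafNN X.famE X.famU X.famF X.d4
  X.N4)` (`b6` the parameter-form block of §(v8b), every other leaf that of `Upstream.ofPrintedAllX`; `rfl`
  bookkeeping `ofPrintedAllXPN_leaves`, `ofPrintedAllXPN_b4_iff`); typed ⇒ NN only (`b4LeafNN_of_leafB4`,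
  `ofPrintedAllXPN_b4_of_ofPrintedAllXP`), NEVER conversely — the typed antecedent is the settled negative edge;
  (iii) the POSITIVE EDGE BY NAME — over carriers `PrintedCarriersR.withNestFamE` whose η-family IS the zero-field
  nested-box family, `ofPrintedAllXPN_withNestFamE_b4_iff`: the NN `b4` leaf ↔ «Prop. 2.3» ∧ «Prop. 3.1′» (quoted,
  over the carriers' own `famU`, `famF`), i.e. DISCHARGED of conjuncts 1 and 4; and over ALL-zero-field carriers
  (`withZeroFieldForms` of `…DagDischarged` v9, `withZeroFieldRegions` of v1, `withNestFamE`) the NN `b4` leaf HOLDS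
  OUTRIGHT, `ofPrintedAllXPN_zeroField_b4` — every statement of node B4, the first in its `0 ≤ α` restriction, being a
  theorem of the package at `A = 0`; (iv) the NET LEDGER `b4_conj1_typed_refuted_nn_proved` ∕
  `b4_bindings_typed_false_nn_iff` (both facts side by side).  HONEST SCOPE: the typed conjunct `B4.ThmPrinted` and the
  typed leaf `B4.LeafB4` (b04's `…B4`, untouched) stay on file as the settled NEGATIVE edge for `α < 0`; the NN
  conjunct for `A ≠ 0`, or on carriers other than the zero-field nested boxes, is NOT claimed (quoted); node 16's
  cell cross-read was still open when this section landed (its theorems are kernel-checked; the cross-read concerns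
  the docstrings' account of the print); `…DagBinding` and `…DagDischarged` are not changed.
  [RECORDS CORRECTION, v5: the preceding sentence was stale when written — node 16's cell cross-read had been
  DELIVERED (XREAD ok, cell GAPS C-pv08g5-4, journal 2026-08-19 13:21:12Z) thirteen minutes BEFORE v4 was submitted;
  recorded as DOCFIX D1 (records-only) of v4's own cross-read, cell GAPS C-pv20-55 ∕ C-carver-g13-2.]

* **v5 — Leaf `b4`, conjunct 1 in its `0 ≤ α` restriction: the NEGATIVE EDGE on b04's VERBATIM carriers (node 17).**
  p. 573: «If Ω⊂Ω₀, then for δG_k(Ω,Ω₀,A) defined by the equality δG_k(Ω,Ω₀,A) = G_k(Ω,A) − G_k(Ω₀,A), (1.11) we have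
  the inequalities … (with the same restrictions on x, x′) with the additional factor … (1.12) on the right hand
  sides.» (held copy `paper:balaban1983-cmp89-regularity-decay`, p0003; the displayed bodies of (1.9) ∕ (1.12) are not
  quoted here) — the print's `D^η_{A,μ}` in (1.9) is a covariant DIFFERENCE (bond) derivative (the cell's reading:
  NOTATION.md §3, nodes 12 ∕ 13 ∕ 17 of the pv17 lineage).  b04's verbatim carriers `B4Cor23ZeroEta.zeroFieldSettingB
  a Mb g` ∕ `zeroFieldSetting a Mb` (and node 13's `nestFamB`, the same carrier over the nested-box instances) read it
  at `A = 0` through the SITE forward difference `B4Cor23Zero.fdiff`, which is `0` at a point `x` on the face of `Ω`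
  whose forward bond leaves `Ω` while at `x′ = x − e_μ` it is the genuine inward normal derivative of `δG_k(Ω,Ω₀,0)·1`
  (OBSERVATION (O-bond) of nodes 12 ∕ 13).  The pv17 lineage's node 17 `…B4Ineq112ZeroNestNegFace` (standalone;
  imports nodes 13 and 16 only, no `Dag…` file) PROVES that this unguarded reading has NO constants for ANY `0 < α` on
  the nested pair `Ω` = one big block ⊂ `Ω₀ = Ω ∪ (Ω + M_b·e_μ)` at large scale (`m² = 0`, source `f = 1`;
  `energy_bound`, `layer_identity`, `exists_face_drop`, `exists_member_violating`; the typed antecedents `regular`,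
  `bigBlocks`, `0 < e ≤ e₁` met; the witness pair lies at η-distance `η < R₀` from `Ω₀∖Ω`, so the restriction
  antecedent is met through b04's parallelepiped disjunct `rect` — p. 573, right after (1.12): «For some simple sets
  Ω, e.g. for rectangular parallelepipeds, the inequalities hold without any restrictions on the points x, x′» — i.e.
  the refutation rests JOINTLY on the unguarded `fdiff` and on that waiver as typed, and the `R₀`-restricted variant
  is not addressed: cross-read INFO I1, cell GAPS C-pv05g13-11): `not_thmPrintedNN_zeroFieldSettingB (ha : 0 < a) (hMb
  : 1 ≤ Mb) (hg : ∀ i f, 0 ≤ g i f) : ¬ ThmPrintedNN (zeroFieldSettingB a Mb g)`, `not_thmPrintedNN_zeroFieldSetting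
  (ha) (hMb) : ¬ ThmPrintedNN (zeroFieldSetting a Mb)`, `not_thmPrintedNN_nestFamB (hℓ : 1 ≤ ℓ) (hm2 : 0 ≤ m2plus)
  (ha) (hMb) (hg)`, and the dichotomy `convention_dichotomy : ThmPrintedNN (nestFam … bdist) ∧ ¬ ThmPrintedNN
  (nestFamB … bdist)` (cell GAPS C-pv17-70, DIVERGENCE D-pv17.30; cross-read ok, cell GAPS C-pv05g13-11; pv17's NOTE
  to b04 + carver, cell journal 2026-08-19 14:12:46Z).  Again a TYPING DEFECT of the transcription (the repair — a
  bond guard on `dlhs19`, node 12's `zeroFieldSettingBond` shape — is b04's call) and NOT a claim against the paper;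
  v4's positive edge is untouched BECAUSE it binds node 12's BOND-convention carrier `zeroFieldSettingBondStd` (node
  13's `thmPrintedNN_nestFam_std`, the ✓ half of the dichotomy), never a verbatim carrier.  This section imports node
  17 and records, additively: (i) at leaf level `not_b4LeafNN_zeroFieldSettingB`, `not_b4LeafNN_zeroFieldSetting`,
  `not_b4LeafNN_nestFamB` (+ the typed `not_leafB4_nestFamB`): the NN leaf `B4LeafNN` of v4 is FALSE whenever its
  η-family is one of b04's verbatim carriers with `g ≥ 0`; (ii) at binding level, over v4's carriers
  `PrintedCarriersR.withZeroFieldFamE` and the new `….withNestFamBE` (η-family := `nestFamB`),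
  `not_ofPrintedAllXPN_withZeroFieldFamE_b4`, `not_ofPrintedAllXPN_withNestFamBE_b4`,
  `not_ofPrintedAllXP_withNestFamBE_b4`: the NN `b4` leaf of `Upstream.ofPrintedAllXPN` is FALSE there and every
  ledger implication routed through `(…).b4` is vacuous on such carriers; (iii) the DICHOTOMY by name,
  `b4LeafNN_convention_dichotomy` (leaf level, default boundary assignment: bond carrier ↔ «Prop. 2.3» ∧ «Prop. 3.1′»,
  verbatim carrier FALSE) and `b4N_bindings_bond_iff_site_false` (binding level: v4's `withNestFamE` ↔ the two quoted
  Propositions, `withNestFamBE` FALSE); (iv) the NET LEDGER `b4_conj1_ledger_v5` (node 16 ∕ node 17 ∕ node 17 ∕ node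
  13 side by side).  HONEST SCOPE: nothing of v1–v4 is re-stated or weakened; `ThmPrintedNN` for `A ≠ 0`, or for a
  re-typed (bond-guarded) verbatim carrier, is NOT claimed (quoted); node 17's cell cross-read was DELIVERED (XREAD
  ok, cell GAPS C-pv05g13-11) before this section landed; `…DagBinding` and `…DagDischarged` are not changed.
  RECORDS: the v4 by-name applications also include b04's `B4.sect5_literal_of_uniform` (`b4LeafNN_sect5_literal`; v4
  cross-read, INFO I1, cell GAPS C-pv20-55).
* **v6 — Leaf `b4`, conjunct 1: the cell REFEREE's RULING on the faithful reading of the Theorem p. 573 (1.8)–(1.12)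
  of [Balaban1983RegularityDecay] («B4-RETYPE: yes», ruling G-ref1-32 of the `ref1` lineage gen 87, cell journal
  2026-08-19 20:40:30Z, answering the carver's request of 2026-08-19 19:43:30Z; renders of pp. 573, 574, 583 read as
  images).**  The ruling, quoted: «(1) Theorem p. 573 Hölder clause: CARRIER transcription defect (print (1.3) D^η_A
  lives on bonds with both end-points in Ω; b04's `zeroFieldSettingB` `fdiff := 0` off-bond extension is not print's;
  faithful carrier = bond-guarded `zeroFieldSettingBond`/`nestFam`; NB print's (1.9) pair x, x′ is ARBITRARY, not
  nearest-neighbour); (2) «α < 1» (Theorem; Lemma 2.4 (2.36)): typed VERBATIM, the α < 0 range is an elided standing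
  Hölder convention at print level (B5 (1.113) writes «0 ≤ α < 1»); faithful range 0 ≤ α < 1 (α = 0 is (2.35) with
  c₁ = 2c₀). S1 ADDITIVE suffices (re-expose `ThmPrintedNN` on bond carriers + `Lemma24PrintedNN` by name, docstring
  flags); S3 in-place `B4.lean` v2 NOT required.»  CONSEQUENCE FOR THIS LEDGER (no new import; nothing of v1–v5
  re-stated or weakened; the leaf keeps its TYPE): of the three kernel facts of `b4_conj1_ledger_v5`, the two NEGATIVE
  edges (node 16: the literal range «α < 1» of `B4.ThmPrinted` refuted for `α < 0`; node 17: the `0 ≤ α` restriction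
  `ThmPrintedNN` refuted on b04's VERBATIM site-difference carriers `zeroFieldSettingB` ∕ `nestFamB`) are, by the
  ruling, defects OF THE TRANSCRIPTION and not readings of the print, while v4's POSITIVE edge — node 13's
  `ThmPrintedNN` on node 12's BOND-guarded carrier — IS the ruled faithful reading of conjunct 1 at `A = 0`.  This
  section records, additively and BY NAME: (i) at leaf level `b4LeafNN_nestFam_iff`: for EVERY admissible boundary
  assignment `g` (`g i f ≤ dist_η(supp f, Ω₀∖Ω)` whenever both sets are non-empty — the class on which node 13's
  `thmPrintedNN_nestFam` is proved; v4 bound the default `g = 0`-free instance `zeroFieldSettingBondStd`, v5 the instance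
  `g = bdist`) the NN leaf over the bond-guarded zero-field nested-box family `nestFam ℓ m²₊ a Mb g` is EQUIVALENT to
  «Prop. 2.3» ∧ «Prop. 3.1′» (quoted), i.e. its conjunct 1 IN THE RULED READING and its conjunct 4 are DISCHARGED
  there (`L = ℓ + 1 ≥ 2`, `a > 0`; antecedents met at every scale, node 13's `threshold_met`, recorded as
  `b4_conj1_ruled_nonvacuous`); (ii) at binding level, over the new carriers `PrintedCarriersR.withNestFamGE` (η-family
  := `nestFam … g`, general admissible `g`), `ofPrintedAllXPN_withNestFamGE_b4_iff`: the NN `b4` leaf of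
  `Upstream.ofPrintedAllXPN` ↔ the two quoted Propositions; (iii) the NET LEDGER AFTER THE RULING,
  `b4_conj1_ledger_v6` — for one and the same admissible `g ≥ 0`: the RULED reading (bond guard, `0 ≤ α < 1`) PROVED
  on the nested boxes (node 13) ∧ the verbatim-carrier reading REFUTED there (node 17) ∧ the literal-range typed
  conjunct REFUTED on the boxes (node 16) — the last two now classified «transcription, not print» by G-ref1-32.
  HONEST SCOPE = the cell's gap census for this conjunct after v6 (cell GAPS C-carver-g14-2): the ruled reading of
  Theorem p. 573 remains a QUOTED HYPOTHESIS, undischarged, for (G1) every `A ≠ 0` (the whole covariant content of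
  the print: (1.8) with the covariant Laplacian Δ^η_A, the regularity condition (1.7) on the plaquette variables),
  and (G2) at `A = 0`, region pairs `Ω ⊂ Ω₀` that are general finite unions of big blocks other than the nested BOXES
  of `NestInst` (print p. 572: «subsets Ω which are unions of big blocks»); the ruling's S1 re-exposure LANDED as
  the template seat's standalone module `…B4RuledReadings` v1 (cell journal 2026-08-19 21:09:34Z; `export` aliases
  `B4.ThmPrintedNN` := node 13's constant and `B4.Lemma24PrintedNN` := node 21's — one constant each in the tree —,
  projections `B4.ThmPrinted.nn` ∕ `B4.thmPrintedNN_iff` ∕ `B4.Lemma24Printed.bound236_nn` …, and the ruling's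
  zero-field ledgers `B4.ruling_thm573_nestFam` ∕ `…_boxFam` ∕ `…_allInstances` ∕ `…_transfer`,
  `B4.ruling_lemma24_zeroFieldScales`, all BY NAME over the node constants, no new `def … : Prop`); it is NOT imported
  here — this file binds node 13's constant directly, which IS `B4.ThmPrintedNN` — and is cited for the record only
  (its cell cross-read open at this landing); no statement of it or of the print is minted in this file (ABSOLUTE
  RULE); `B4.Lemma24Printed` (Lemma 2.4 p. 582) is not a DAG-leaf conjunct and its ruled reading needs no binding; the
  consumer `ofPrinted_b4_of_quoted` of `…DagDischarged` keeps «Theorem p. 573» as its quoted hypothesis `h₁` AS TYPED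
  (`B4.ThmPrinted`), which by node 16 no zero-field box family can satisfy — the N-binding `Upstream.ofPrintedAllXPN`
  (v4) is the binding that carries the ruled reading.  POINTERS (no binding owed; not leaf conjuncts by name): node 18
  `…B4ThmZeroNestAlphaZero` v1.1 (`thmPrintedNN_bond_of_B`: on every zero-field family the verbatim reading implies the
  ruled one at the same constants; `leafClause_zero_bond_iff_B`: at the endpoint `α = 0` the two conventions agree;
  `perClause_nestFamB`: for `0 < α < 1` the verbatim defect sits in the unguarded δG-Hölder field (1.11) alone), and
  the pv17 lineage's `B4Eq220CommutatorZeroBox` (the per-factor step of (2.20)∕(2.21) at `A = 0`, cell journal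
  2026-08-19 20:03Z) — Lemma 2.2 ∕ (2.20)–(2.22) are proof-internal statements of [Balaban1983RegularityDecay], not
  DAG-leaf conjuncts.

ABSOLUTE RULE.  Nothing printed is asserted here: every `theorem` below is either bookkeeping (`Iff` ∕ `rfl` ∕
projections) over the leaf types of `…DagBinding` ∕ `…DagDischarged`, or the application BY NAME of a theorem
kernel-proved elsewhere in this package; no Literature fact is minted, no programme-internal claim is cited, and
the manuscripts under audit are quoted only inside docstrings as the TYPES being bound.

**Value = typed skeleton + citation DAG + located gaps, NOT summit progress**: the Yang–Mills ∕ `Summit.QuantumFields`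
statements are untouched.
-/

namespace Literature.MathematicalPhysics.QuantumFieldTheory.Balaban1983to89.DagDischargedII

open DagBinding DagDischarged

/-! ## Leaf `b4`, conjunct 2 — «Proposition 2.3 of [1]» (1.15)–(1.20) for the zero-field nested-region carriers, `Ω ⊂ Ω₀` general unions of `L`-blocks, `A = 0` (v1) -/
section LeafB4Prop23ZeroRegion

/-- **«Proposition 2.3 of [1]» (1.15)–(1.20), AS TYPED, for the zero-field nested-region carriers (complements read
inside `Ω^{(k)}`), every `d`, every `ℓ ≥ 1`, every window `0 < a₋`, `0 < a₂₋`** — the pv17 lineage's theorem, by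
name. [cite: Balaban1983RegularityDecay, Prop. 2.3 of [1] (1.15)–(1.20) p.574 (kernel version for the typed zero-field nested-region carriers of …B4Prop23ZeroRegion, A = 0)] -/
theorem prop23Printed_zeroFieldRegions (d ℓ : ℕ) (hℓ : 1 ≤ ℓ) {aminus aplus m2plus a2minus a2plus : ℝ}
    (ha : 0 < aminus) (ha2 : 0 < a2minus) :
    B4.Prop23Printed (B4Prop23ZeroRegion.zeroFieldRegions d ℓ aminus aplus m2plus a2minus a2plus) :=
  B4Prop23ZeroRegion.prop23Printed_zeroFieldRegions d ℓ hℓ ha ha2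

/-- **The same for the carriers with the LITERAL complements `Λ^c = Z^d ∖ Λ`, `Ω^{(k)c} = Z^d ∖ Ω^{(k)}`** — the pv17
lineage's theorem, by name. [cite: Balaban1983RegularityDecay, Prop. 2.3 of [1] (1.15)–(1.20) p.574 (kernel version for the typed zero-field nested-region carriers with literal complements, A = 0)] -/
theorem prop23Printed_zeroFieldRegionsLit (d ℓ : ℕ) (hℓ : 1 ≤ ℓ) {aminus aplus m2plus a2minus a2plus : ℝ}
    (ha : 0 < aminus) (ha2 : 0 < a2minus) :
    B4.Prop23Printed (B4Prop23ZeroRegion.zeroFieldRegionsLit d ℓ aminus aplus m2plus a2minus a2plus) :=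
  B4Prop23ZeroRegion.prop23Printed_zeroFieldRegionsLit d ℓ hℓ ha ha2

/-- **Leaf `b4` over the zero-field nested-region carriers is EQUIVALENT to TWO quoted statements**: Theorem p. 573
over `famE` and «Prop. 3.1′ of [2]» over `famF` — conjunct 2 is `prop23Printed_zeroFieldRegions`, conjunct 4 (Sect. 5
Theorem) is `B4Sect5Proof.sect5ThmUniform_holds` (`DagDischarged.leafB4_iff_quoted`). [cite: Balaban1983RegularityDecay, Theorem p.573, Prop. 3.1′ of [2] p.574 (quoted); Prop. 2.3 of [1] p.574 (proved for the typed zero-field nested-region carriers, A = 0); Sect. 5 Theorem p.594 (proved)] -/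
theorem leafB4_zeroFieldRegions_iff {I₁ I₃ : Type} (famE : I₁ → B4.EtaSetting) (famF : I₃ → B4.FormSetting)
    (d ℓ : ℕ) (hℓ : 1 ≤ ℓ) {aminus aplus m2plus a2minus a2plus : ℝ} (ha : 0 < aminus) (ha2 : 0 < a2minus)
    (d4 N4 : ℕ) :
    B4.LeafB4 famE (B4Prop23ZeroRegion.zeroFieldRegions d ℓ aminus aplus m2plus a2minus a2plus) famF d4 N4 ↔
      B4.ThmPrinted famE ∧ B4.Prop31Printed famF :=
  (leafB4_iff_quoted famE (B4Prop23ZeroRegion.zeroFieldRegions d ℓ aminus aplus m2plus a2minus a2plus) famF d4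
      N4).trans
    ⟨fun h => ⟨h.1, h.2.2⟩, fun h => ⟨h.1, prop23Printed_zeroFieldRegions d ℓ hℓ ha ha2, h.2⟩⟩

/-- The same equivalence over the carriers with the literal complements. [cite: Balaban1983RegularityDecay, Theorem p.573, Prop. 3.1′ of [2] p.574 (quoted); Prop. 2.3 of [1] p.574 (proved for the typed carriers with literal complements, A = 0); Sect. 5 Theorem p.594 (proved)] -/
theorem leafB4_zeroFieldRegionsLit_iff {I₁ I₃ : Type} (famE : I₁ → B4.EtaSetting) (famF : I₃ → B4.FormSetting)
    (d ℓ : ℕ) (hℓ : 1 ≤ ℓ) {aminus aplus m2plus a2minus a2plus : ℝ} (ha : 0 < aminus) (ha2 : 0 < a2minus)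
    (d4 N4 : ℕ) :
    B4.LeafB4 famE (B4Prop23ZeroRegion.zeroFieldRegionsLit d ℓ aminus aplus m2plus a2minus a2plus) famF d4 N4 ↔
      B4.ThmPrinted famE ∧ B4.Prop31Printed famF :=
  (leafB4_iff_quoted famE (B4Prop23ZeroRegion.zeroFieldRegionsLit d ℓ aminus aplus m2plus a2minus a2plus) famF d4
      N4).trans
    ⟨fun h => ⟨h.1, h.2.2⟩, fun h => ⟨h.1, prop23Printed_zeroFieldRegionsLit d ℓ hℓ ha ha2, h.2⟩⟩

/-- **Leaf `b4` over the zero-field nested-region carriers (for `famU`) and the zero-field form family of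
`…DagDischarged` v9 (for `famF`) is EQUIVALENT to ONE quoted statement**, Theorem p. 573 over `famE`. [cite: Balaban1983RegularityDecay, Theorem p.573 (quoted); Prop. 2.3 of [1] and Prop. 3.1′ of [2] p.574 (proved for the typed zero-field carriers, A = 0); Sect. 5 Theorem p.594 (proved)] -/
theorem leafB4_zeroFieldRegionsForms_iff {I₁ : Type} (famE : I₁ → B4.EtaSetting) (d ℓ : ℕ) (hℓ : 1 ≤ ℓ)
    {aminus aplus m2plus a2minus a2plus : ℝ} (ha : 0 < aminus) (ha2 : 0 < a2minus) (d' : ℕ) {amin' m2max' : ℝ}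
    (hamin' : 0 < amin') (hmax' : 0 ≤ m2max') (d4 N4 : ℕ) :
    B4.LeafB4 famE (B4Prop23ZeroRegion.zeroFieldRegions d ℓ aminus aplus m2plus a2minus a2plus)
        (B4Prop31Zero.zeroFieldForms d' amin' m2max') d4 N4 ↔ B4.ThmPrinted famE :=
  (leafB4_zeroFieldRegions_iff famE (B4Prop31Zero.zeroFieldForms d' amin' m2max') d ℓ hℓ ha ha2 d4 N4).trans
    ⟨fun h => h.1, fun h => ⟨h, prop31Printed_zeroFieldForms d' hamin' hmax'⟩⟩

/-- Binding carriers whose B4 unit-lattice family (the carriers of «Proposition 2.3 of [1]») IS the zero-field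
nested-region family of `…B4Prop23ZeroRegion` (index type `B4Prop23ZeroRegion.ZeroRegionIdx d ℓ a₋ a₊ m²₊ a₂₋ a₂₊`;
every other carrier — in particular `famE`, `famF` and `(d4, N4)` — unchanged). [folklore] -/
noncomputable def _root_.Literature.MathematicalPhysics.QuantumFieldTheory.Balaban1983to89.DagBinding.PrintedCarriersR.withZeroFieldRegions
    (X : PrintedCarriersR) (d ℓ : ℕ) (aminus aplus m2plus a2minus a2plus : ℝ) : PrintedCarriersR :=
  { X with I4U := B4Prop23ZeroRegion.ZeroRegionIdx d ℓ aminus aplus m2plus a2minus a2plus,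
           famU := B4Prop23ZeroRegion.zeroFieldRegions d ℓ aminus aplus m2plus a2minus a2plus }

/-- The same with the literal-complement carriers `zeroFieldRegionsLit`. [folklore] -/
noncomputable def _root_.Literature.MathematicalPhysics.QuantumFieldTheory.Balaban1983to89.DagBinding.PrintedCarriersR.withZeroFieldRegionsLit
    (X : PrintedCarriersR) (d ℓ : ℕ) (aminus aplus m2plus a2minus a2plus : ℝ) : PrintedCarriersR :=
  { X with I4U := B4Prop23ZeroRegion.ZeroRegionIdx d ℓ aminus aplus m2plus a2minus a2plus,
           famU := B4Prop23ZeroRegion.zeroFieldRegionsLit d ℓ aminus aplus m2plus a2minus a2plus }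

/-- The `b4` field of the current P-binding over such carriers IS `B4.LeafB4` with the zero-field nested-region
family (bookkeeping, `rfl`). [folklore] -/
theorem ofPrintedAllXP_withZeroFieldRegions_b4_eq (X : PrintedCarriersR) (Y : PrintedCarriers9X)
    (Z : PrintedCarriers11) (V : PrintedCarriers14R) (W : PrintedCarriers15) (d ℓ : ℕ)
    (aminus aplus m2plus a2minus a2plus : ℝ) :
    (Upstream.ofPrintedAllXP (X.withZeroFieldRegions d ℓ aminus aplus m2plus a2minus a2plus) Y Z V W).b4 =
      B4.LeafB4 X.famE (B4Prop23ZeroRegion.zeroFieldRegions d ℓ aminus aplus m2plus a2minus a2plus) X.famF X.d4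
        X.N4 :=
  rfl

/-- The same for the literal-complement carriers (`rfl`). [folklore] -/
theorem ofPrintedAllXP_withZeroFieldRegionsLit_b4_eq (X : PrintedCarriersR) (Y : PrintedCarriers9X)
    (Z : PrintedCarriers11) (V : PrintedCarriers14R) (W : PrintedCarriers15) (d ℓ : ℕ)
    (aminus aplus m2plus a2minus a2plus : ℝ) :
    (Upstream.ofPrintedAllXP (X.withZeroFieldRegionsLit d ℓ aminus aplus m2plus a2minus a2plus) Y Z V W).b4 =
      B4.LeafB4 X.famE (B4Prop23ZeroRegion.zeroFieldRegionsLit d ℓ aminus aplus m2plus a2minus a2plus) X.famF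
        X.d4 X.N4 :=
  rfl

/-- **Leaf `b4` of the current P-binding, for carriers with the zero-field nested-region family, is EQUIVALENT to
Theorem p. 573 and «Prop. 3.1′ of [2]»** (over the carriers' own `famE`, `famF`). [cite: Balaban1983RegularityDecay, Theorem p.573, Prop. 3.1′ of [2] p.574 (quoted); Prop. 2.3 of [1] p.574 (proved for the typed zero-field nested-region carriers, A = 0); Sect. 5 Theorem p.594 (proved)] -/
theorem ofPrintedAllXP_withZeroFieldRegions_b4_iff (X : PrintedCarriersR) (Y : PrintedCarriers9X)
    (Z : PrintedCarriers11) (V : PrintedCarriers14R) (W : PrintedCarriers15) (d ℓ : ℕ) (hℓ : 1 ≤ ℓ)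
    {aminus aplus m2plus a2minus a2plus : ℝ} (ha : 0 < aminus) (ha2 : 0 < a2minus) :
    (Upstream.ofPrintedAllXP (X.withZeroFieldRegions d ℓ aminus aplus m2plus a2minus a2plus) Y Z V W).b4 ↔
      B4.ThmPrinted X.famE ∧ B4.Prop31Printed X.famF := by
  rw [ofPrintedAllXP_withZeroFieldRegions_b4_eq]
  exact leafB4_zeroFieldRegions_iff X.famE X.famF d ℓ hℓ ha ha2 X.d4 X.N4

/-- The same for the literal-complement carriers. [cite: Balaban1983RegularityDecay, Theorem p.573, Prop. 3.1′ of [2] p.574 (quoted); Prop. 2.3 of [1] p.574 (proved for the typed carriers with literal complements, A = 0); Sect. 5 Theorem p.594 (proved)] -/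
theorem ofPrintedAllXP_withZeroFieldRegionsLit_b4_iff (X : PrintedCarriersR) (Y : PrintedCarriers9X)
    (Z : PrintedCarriers11) (V : PrintedCarriers14R) (W : PrintedCarriers15) (d ℓ : ℕ) (hℓ : 1 ≤ ℓ)
    {aminus aplus m2plus a2minus a2plus : ℝ} (ha : 0 < aminus) (ha2 : 0 < a2minus) :
    (Upstream.ofPrintedAllXP (X.withZeroFieldRegionsLit d ℓ aminus aplus m2plus a2minus a2plus) Y Z V W).b4 ↔
      B4.ThmPrinted X.famE ∧ B4.Prop31Printed X.famF := by
  rw [ofPrintedAllXP_withZeroFieldRegionsLit_b4_eq]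
  exact leafB4_zeroFieldRegionsLit_iff X.famE X.famF d ℓ hℓ ha ha2 X.d4 X.N4

/-- The two quoted statements give that leaf. [cite: Balaban1983RegularityDecay, Theorem p.573, Prop. 3.1′ of [2] p.574 (quoted)] -/
theorem ofPrintedAllXP_withZeroFieldRegions_b4_of_quoted (X : PrintedCarriersR) (Y : PrintedCarriers9X)
    (Z : PrintedCarriers11) (V : PrintedCarriers14R) (W : PrintedCarriers15) (d ℓ : ℕ) (hℓ : 1 ≤ ℓ)
    {aminus aplus m2plus a2minus a2plus : ℝ} (ha : 0 < aminus) (ha2 : 0 < a2minus) (h₁ : B4.ThmPrinted X.famE)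
    (h₃ : B4.Prop31Printed X.famF) :
    (Upstream.ofPrintedAllXP (X.withZeroFieldRegions d ℓ aminus aplus m2plus a2minus a2plus) Y Z V W).b4 :=
  (ofPrintedAllXP_withZeroFieldRegions_b4_iff X Y Z V W d ℓ hℓ ha ha2).2 ⟨h₁, h₃⟩

/-- The same at the K-binding of `…DagDischarged` v3 (its `b4` field is the P-binding's, `ofPrintedAllXPK_leaves`),
every κ. [cite: Balaban1983RegularityDecay, Theorem p.573, Prop. 3.1′ of [2] p.574 (quoted); Prop. 2.3 of [1] p.574 (proved for the typed zero-field nested-region carriers, A = 0)] -/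
theorem ofPrintedAllXPK_withZeroFieldRegions_b4_iff (X : PrintedCarriersR) (Y : PrintedCarriers9X)
    (Z : PrintedCarriers11) (V : PrintedCarriers14R) (W : PrintedCarriers15) (κ : ℝ) (d ℓ : ℕ) (hℓ : 1 ≤ ℓ)
    {aminus aplus m2plus a2minus a2plus : ℝ} (ha : 0 < aminus) (ha2 : 0 < a2minus) :
    (Upstream.ofPrintedAllXPK (X.withZeroFieldRegions d ℓ aminus aplus m2plus a2minus a2plus) Y Z V W κ).b4 ↔
      B4.ThmPrinted X.famE ∧ B4.Prop31Printed X.famF := by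
  rw [(ofPrintedAllXPK_leaves (X.withZeroFieldRegions d ℓ aminus aplus m2plus a2minus a2plus) Y Z V W κ).2.1]
  exact ofPrintedAllXP_withZeroFieldRegions_b4_iff X Y Z V W d ℓ hℓ ha ha2

/-- **Leaf `b4` of the current P-binding, for carriers with BOTH the zero-field form family (v9, `famF`) and the
zero-field nested-region family (`famU`), is EQUIVALENT to Theorem p. 573 ALONE** — three of the four printed
statements of node B4 are then theorems of the package for these carriers. [cite: Balaban1983RegularityDecay, Theorem p.573 (quoted); Props. p.574 (proved for the typed zero-field carriers, A = 0); Sect. 5 Theorem p.594 (proved)] -/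
theorem ofPrintedAllXP_withZeroFieldRegionsForms_b4_iff (X : PrintedCarriersR) (Y : PrintedCarriers9X)
    (Z : PrintedCarriers11) (V : PrintedCarriers14R) (W : PrintedCarriers15) (d' : ℕ) {amin' m2max' : ℝ}
    (hamin' : 0 < amin') (hmax' : 0 ≤ m2max') (d ℓ : ℕ) (hℓ : 1 ≤ ℓ) {aminus aplus m2plus a2minus a2plus : ℝ}
    (ha : 0 < aminus) (ha2 : 0 < a2minus) :
    (Upstream.ofPrintedAllXP
        ((X.withZeroFieldForms d' amin' m2max').withZeroFieldRegions d ℓ aminus aplus m2plus a2minus a2plus)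
        Y Z V W).b4 ↔ B4.ThmPrinted X.famE :=
  (ofPrintedAllXP_withZeroFieldRegions_b4_iff (X.withZeroFieldForms d' amin' m2max') Y Z V W d ℓ hℓ ha
      ha2).trans
    ⟨fun h => h.1, fun h => ⟨h, prop31Printed_zeroFieldForms d' hamin' hmax'⟩⟩

/-- NET LEDGER for node `b4` over carriers with the zero-field form family and the zero-field nested-region family:
of the four printed statements bundled in the leaf, THREE are theorems of the package for these carriers (Prop. 2.3,
«Prop. 3.1′ of [2]», Sect. 5 Theorem) and ONE stays quoted (Theorem p. 573 = Prop. 2.1 of [1], the A-dependent decay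
∕ regularity of G_k(Ω, A)). [cite: Balaban1983RegularityDecay, Theorem p.573, Props. p.574, Sect. 5 Theorem p.594] -/
theorem b4_zeroFieldRegionsForms_proved_conjuncts (X : PrintedCarriersR) (d' : ℕ) {amin' m2max' : ℝ}
    (hamin' : 0 < amin') (hmax' : 0 ≤ m2max') (d ℓ : ℕ) (hℓ : 1 ≤ ℓ) {aminus aplus m2plus a2minus a2plus : ℝ}
    (ha : 0 < aminus) (ha2 : 0 < a2minus) :
    let X' := (X.withZeroFieldForms d' amin' m2max').withZeroFieldRegions d ℓ aminus aplus m2plus a2minus a2plus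
    B4.Prop23Printed X'.famU ∧ B4.Prop31Printed X'.famF ∧ B4.Sect5ThmUniform X'.d4 X'.N4 :=
  ⟨prop23Printed_zeroFieldRegions d ℓ hℓ ha ha2, prop31Printed_zeroFieldForms d' hamin' hmax',
    B4Sect5Proof.sect5ThmUniform_holds X.d4 X.N4⟩

/-- Conjunct 2 of leaf `b4` is now a theorem of the package for FOUR concrete zero-field `famU` families: the nested
Neumann boxes of `…DagDischarged` v10, the whole torus of v11 (`Ω = Ω₀ = T^{(j)}`), and the nested block-union regions
of this section in both complement readings — the printed «Ω which are unions of big blocks», «Ω ⊂ Ω₀» at `A = 0`.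
[cite: Balaban1983RegularityDecay, Prop. 2.3 of [1] (1.15)–(1.20) p.574 (kernel versions for the four typed zero-field families, A = 0)] -/
theorem leafB4_conj2_zeroField_four_families (d ℓ : ℕ) (hℓ : 1 ≤ ℓ) {aminus aplus m2plus a2minus a2plus : ℝ}
    (ha : 0 < aminus) (ha2 : 0 < a2minus) (d₂ L : ℕ) (hd₂ : 1 ≤ d₂) (hL : Odd L ∧ 1 < L) {a : ℝ} (ha' : 0 < a)
    (m2plus' : ℝ) :
    B4.Prop23Printed (B4Prop23ZeroBox.zeroFieldBoxes d ℓ aminus aplus m2plus a2minus a2plus) ∧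
      B4.Prop23Printed (B4Ineq118Torus.torusFam d₂ L a m2plus') ∧
        B4.Prop23Printed (B4Prop23ZeroRegion.zeroFieldRegions d ℓ aminus aplus m2plus a2minus a2plus) ∧
          B4.Prop23Printed (B4Prop23ZeroRegion.zeroFieldRegionsLit d ℓ aminus aplus m2plus a2minus a2plus) :=
  ⟨prop23Printed_zeroFieldBoxes d ℓ hℓ ha ha2, leafB4_conj2_torusFam d₂ L hd₂ hL ha' m2plus',
    prop23Printed_zeroFieldRegions d ℓ hℓ ha ha2, prop23Printed_zeroFieldRegionsLit d ℓ hℓ ha ha2⟩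

end LeafB4Prop23ZeroRegion

/-! ## Leaf `b8`, conjunct `l1` — Lemma 1 (1.25) p. 79 for the NON-ABELIAN block-pair carriers, `G = U1 𝔸`-valued bond fields (v2) -/
section LeafB8Lemma1NonAbelian

/-- **Lemma 1 (1.25), AS TYPED, for the non-abelian block-pair carriers `blockPairNA d L 𝔸`, every `d`, every `L`,
every complete normed `ℂ`-algebra `𝔸` with `‖1‖ = 1`** — the b08 lineage's theorem, by name. [cite: Balaban1985RegularSpaces, Lemma 1 (1.24)–(1.25) pp.79–80 (kernel version for the typed non-abelian carriers of …B8Lemma1NonAbelian; proof the package's)] -/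
theorem lemma1Printed_blockPairNA (d L : ℕ) (𝔸 : Type) [NormedRing 𝔸] [NormOneClass 𝔸] [NormedAlgebra ℂ 𝔸]
    [CompleteSpace 𝔸] : B8.Lemma1Printed d (B8Lemma1NonAbelian.blockPairNA d L 𝔸) :=
  B8Lemma1NonAbelian.lemma1Printed_blockPairNA d L 𝔸

/-- The simplest inhabitant of the typeclass package: `𝔸 = ℂ` (the one-dimensional case, `U1 ℂ` = the closed unit
circle's units read multiplicatively) — conjunct `l1` for `blockPairNA d L ℂ`, by name. [cite: Balaban1985RegularSpaces, Lemma 1 (1.24)–(1.25) pp.79–80 (kernel version for the typed non-abelian carriers of …B8Lemma1NonAbelian at 𝔸 = ℂ)] -/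
theorem lemma1Printed_blockPairNA_complex (d L : ℕ) : B8.Lemma1Printed d (B8Lemma1NonAbelian.blockPairNA d L ℂ) :=
  lemma1Printed_blockPairNA d L ℂ

/-- **Conjunct `l1` of leaf `b8` is a theorem of the package for TWO concrete carrier families**: the abelian
(additive) block pairs of `…DagDischarged` v8 and the non-abelian block pairs of this section. [cite: Balaban1985RegularSpaces, Lemma 1 (1.24)–(1.25) pp.79–80 (kernel versions for the two typed block-pair families)] -/
theorem leafB8_l1_two_families (d L : ℕ) (𝔸 : Type) [NormedRing 𝔸] [NormOneClass 𝔸] [NormedAlgebra ℂ 𝔸]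
    [CompleteSpace 𝔸] :
    B8.Lemma1Printed d (B8Lemma1Lattice.blockPair d L) ∧ B8.Lemma1Printed d (B8Lemma1NonAbelian.blockPairNA d L 𝔸) :=
  ⟨lemma1Printed_blockPair d L, lemma1Printed_blockPairNA d L 𝔸⟩

/-- **For the non-abelian block-pair carriers the faithful B8 leaf is EQUIVALENT to its eight quoted statements** —
Lemma 1 needs no quotation (every natural block size `Lb` of the `l1` carriers; the leaf's real parameter `L` is
untouched). [cite: Balaban1985RegularSpaces, Lemma 1 p.79 (proved for the typed non-abelian carriers); Thm 2 – Thm 8 pp.83–101 (quoted)] -/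
theorem b8LeafR_blockPairNA_iff {I₂ I₃ I₄ : Type} (d Lb : ℕ) (𝔸 : Type) [NormedRing 𝔸] [NormOneClass 𝔸]
    [NormedAlgebra ℂ 𝔸] [CompleteSpace 𝔸] (L C₂ B₁' B₀' B₁ B₂ c₁ : ℝ) (inp : B8.B9Inputs) (B₀β : ℝ)
    (fam : I₂ → B8SectGH.GFData3) (lan : I₃ → B8.LandauData) (cub : I₄ → B8.CubeData)
    (toAxial : ∀ i, (fam i).Cfg → (fam i).Pert → (fam i).Pert) :
    B8LeafR d L C₂ B₁' B₀' B₁ B₂ c₁ inp B₀β (B8Lemma1NonAbelian.blockPairNA d Lb 𝔸) fam lan cub toAxial ↔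
      B8LeafRest d L C₂ B₁' B₀' B₁ B₂ c₁ inp B₀β fam lan cub toAxial := by
  rw [b8LeafR_iff_l1_and_rest]
  exact ⟨fun h => h.2, fun h => ⟨lemma1Printed_blockPairNA d Lb 𝔸, h⟩⟩

/-- The eight quoted statements give the faithful leaf for these carriers. [cite: Balaban1985RegularSpaces, Thm 2 – Thm 8 pp.83–101 (quoted)] -/
theorem b8LeafR_blockPairNA_of_rest {I₂ I₃ I₄ : Type} (d Lb : ℕ) (𝔸 : Type) [NormedRing 𝔸] [NormOneClass 𝔸]
    [NormedAlgebra ℂ 𝔸] [CompleteSpace 𝔸] (L C₂ B₁' B₀' B₁ B₂ c₁ : ℝ) (inp : B8.B9Inputs) (B₀β : ℝ)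
    (fam : I₂ → B8SectGH.GFData3) (lan : I₃ → B8.LandauData) (cub : I₄ → B8.CubeData)
    (toAxial : ∀ i, (fam i).Cfg → (fam i).Pert → (fam i).Pert)
    (h : B8LeafRest d L C₂ B₁' B₀' B₁ B₂ c₁ inp B₀β fam lan cub toAxial) :
    B8LeafR d L C₂ B₁' B₀' B₁ B₂ c₁ inp B₀β (B8Lemma1NonAbelian.blockPairNA d Lb 𝔸) fam lan cub toAxial :=
  (b8LeafR_blockPairNA_iff d Lb 𝔸 L C₂ B₁' B₀' B₁ B₂ c₁ inp B₀β fam lan cub toAxial).2 h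

/-- Binding carriers whose B8 Lemma-1 data are the NON-ABELIAN block-pair carriers over `𝔸` at natural block size
`Lb` (index type `Site X.d8 × Fin X.d8`; every other carrier, and the real parameter `L8`, unchanged). [folklore] -/
noncomputable def _root_.Literature.MathematicalPhysics.QuantumFieldTheory.Balaban1983to89.DagBinding.PrintedCarriersR.withBlockPairNA
    (X : PrintedCarriersR) (Lb : ℕ) (𝔸 : Type) [NormedRing 𝔸] [NormOneClass 𝔸] [NormedAlgebra ℂ 𝔸]
    [CompleteSpace 𝔸] : PrintedCarriersR :=
  { X with I8a := B7Prop1Explicit.Site X.d8 × Fin X.d8, loc8 := B8Lemma1NonAbelian.blockPairNA X.d8 Lb 𝔸 }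

/-- Bookkeeping (`rfl`): the substituted carriers carry the non-abelian block-pair Lemma-1 data. [folklore] -/
theorem withBlockPairNA_loc8 (X : PrintedCarriersR) (Lb : ℕ) (𝔸 : Type) [NormedRing 𝔸] [NormOneClass 𝔸]
    [NormedAlgebra ℂ 𝔸] [CompleteSpace 𝔸] :
    (X.withBlockPairNA Lb 𝔸).loc8 = B8Lemma1NonAbelian.blockPairNA X.d8 Lb 𝔸 :=
  rfl

/-- **Leaf `b8` of the current P-binding, for carriers with the non-abelian block-pair Lemma-1 data, is EQUIVALENT
to the eight quoted statements Thm 2 – Thm 8** (`B8LeafRest` over the carriers' own B8 data). [cite: Balaban1985RegularSpaces, Lemma 1 p.79 (proved for the typed non-abelian carriers); Thm 2 – Thm 8 pp.83–101 (quoted)] -/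
theorem ofPrintedAllXP_withBlockPairNA_b8_iff (X : PrintedCarriersR) (Y : PrintedCarriers9X) (Z : PrintedCarriers11)
    (V : PrintedCarriers14R) (W : PrintedCarriers15) (Lb : ℕ) (𝔸 : Type) [NormedRing 𝔸] [NormOneClass 𝔸]
    [NormedAlgebra ℂ 𝔸] [CompleteSpace 𝔸] :
    (Upstream.ofPrintedAllXP (X.withBlockPairNA Lb 𝔸) Y Z V W).b8 ↔
      B8LeafRest X.d8 X.L8 X.C₂ X.B₁' X.B₀' X.B₁ X.B₂ X.c₁ X.inp8 X.B₀β X.fam8R X.lan8 X.cub8 X.toAxial8 :=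
  b8LeafR_blockPairNA_iff X.d8 Lb 𝔸 X.L8 X.C₂ X.B₁' X.B₀' X.B₁ X.B₂ X.c₁ X.inp8 X.B₀β X.fam8R X.lan8 X.cub8
    X.toAxial8

/-- The quoted statements give that leaf. [cite: Balaban1985RegularSpaces, Thm 2 – Thm 8 pp.83–101 (quoted)] -/
theorem ofPrintedAllXP_withBlockPairNA_b8_of_rest (X : PrintedCarriersR) (Y : PrintedCarriers9X)
    (Z : PrintedCarriers11) (V : PrintedCarriers14R) (W : PrintedCarriers15) (Lb : ℕ) (𝔸 : Type) [NormedRing 𝔸]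
    [NormOneClass 𝔸] [NormedAlgebra ℂ 𝔸] [CompleteSpace 𝔸]
    (h : B8LeafRest X.d8 X.L8 X.C₂ X.B₁' X.B₀' X.B₁ X.B₂ X.c₁ X.inp8 X.B₀β X.fam8R X.lan8 X.cub8 X.toAxial8) :
    (Upstream.ofPrintedAllXP (X.withBlockPairNA Lb 𝔸) Y Z V W).b8 :=
  (ofPrintedAllXP_withBlockPairNA_b8_iff X Y Z V W Lb 𝔸).2 h

/-- The same at the K-binding of `…DagDischarged` v3 (its `b8` field is the P-binding's), every κ. [cite: Balaban1985RegularSpaces, Lemma 1 p.79 (proved for the typed non-abelian carriers); Thm 2 – Thm 8 pp.83–101 (quoted)] -/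
theorem ofPrintedAllXPK_withBlockPairNA_b8_iff (X : PrintedCarriersR) (Y : PrintedCarriers9X)
    (Z : PrintedCarriers11) (V : PrintedCarriers14R) (W : PrintedCarriers15) (κ : ℝ) (Lb : ℕ) (𝔸 : Type)
    [NormedRing 𝔸] [NormOneClass 𝔸] [NormedAlgebra ℂ 𝔸] [CompleteSpace 𝔸] :
    (Upstream.ofPrintedAllXPK (X.withBlockPairNA Lb 𝔸) Y Z V W κ).b8 ↔
      B8LeafRest X.d8 X.L8 X.C₂ X.B₁' X.B₀' X.B₁ X.B₂ X.c₁ X.inp8 X.B₀β X.fam8R X.lan8 X.cub8 X.toAxial8 :=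
  b8LeafR_blockPairNA_iff X.d8 Lb 𝔸 X.L8 X.C₂ X.B₁' X.B₀' X.B₁ X.B₂ X.c₁ X.inp8 X.B₀β X.fam8R X.lan8 X.cub8
    X.toAxial8

/-- Downstream bookkeeping: for these carriers Theorem 8 at γ = 1 — what B9 consumes from the leaf
(`DagBinding.ofPrintedR_b8_thm8`) — comes from the quoted rest alone. [cite: Balaban1985RegularSpaces, Thm 8 (1.146) p.101 (quoted)] -/
theorem thm8_withBlockPairNA_of_rest (X : PrintedCarriersR) (Lb : ℕ) (𝔸 : Type) [NormedRing 𝔸] [NormOneClass 𝔸]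
    [NormedAlgebra ℂ 𝔸] [CompleteSpace 𝔸]
    (h : B8LeafRest X.d8 X.L8 X.C₂ X.B₁' X.B₀' X.B₁ X.B₂ X.c₁ X.inp8 X.B₀β X.fam8R X.lan8 X.cub8 X.toAxial8) :
    B8SectGH.Thm8PrintedAt 1 (X.withBlockPairNA Lb 𝔸).B₁ (X.withBlockPairNA Lb 𝔸).B₂ (X.withBlockPairNA Lb 𝔸).fam8R :=
  h.t8

end LeafB8Lemma1NonAbelian

/-! ## Leaf `b7`, conjuncts `p1` ∧ `p2` — Proposition 1 (51) and Proposition 2 (52)–(54) p. 26 for the CONCRETE block averages (42) ∕ (43) on `ℤ^d` (v3) -/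
section LeafB7Prop12Concrete

/-- The QUOTED REST of leaf `b7`: Propositions 3–10 of [Balaban1985Averaging] as typed in `…B7` (`B7.Concl` without
its `p1`, `p2` fields), over the leaf's own carriers — every conjunct a verbatim printed statement used as a
hypothesis, unchanged. [cite: Balaban1985Averaging, Prop. 3 p.36, Prop. 4 pp.38–39, Prop. 5 p.42, Props. 6–7 p.43, Prop. 8 p.45, Prop. 9 p.49, Prop. 10 p.50 (quoted)] -/
def B7LeafRest {I₁ I₃ I₄ I₅ : Type} (L c₂ : ℝ) (one : I₁ → B7.OneStep) (kexp : I₃ → B7.KExp)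
    (gd : I₄ → B7.GaugeData) (gone : I₅ → B7.GaugeOneStep) : Prop :=
  B7.Prop3Printed L c₂ one ∧ B7.Prop4Printed kexp ∧ B7.Prop5Printed kexp ∧ B7.Prop6Printed kexp ∧
    B7.Prop7Printed kexp ∧ B7.Prop8Printed gd ∧ B7.Prop9Printed L gone ∧ B7.Prop10Printed gd

/-- Bookkeeping: leaf `b7` (`B7.Concl`) is `(p1 ∧ p2) ∧` its quoted rest. [cite: Balaban1985Averaging, Props. 1–2 p.26, Props. 3–10 pp.36–50 (the leaf's ten fields)] -/
theorem b7Concl_iff_p12_and_rest {I₁ I₂ I₃ I₄ I₅ : Type} (L c₂ C₀ c₂' : ℝ) (one : I₁ → B7.OneStep)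
    (kst : I₂ → B7.KStep) (kexp : I₃ → B7.KExp) (gd : I₄ → B7.GaugeData) (gone : I₅ → B7.GaugeOneStep) :
    B7.Concl L c₂ C₀ c₂' one kst kexp gd gone ↔
      (B7.Prop1Printed L one ∧ B7.Prop2Printed C₀ c₂' kst) ∧ B7LeafRest L c₂ one kexp gd gone :=
  ⟨fun h => ⟨⟨h.p1, h.p2⟩, h.p3, h.p4, h.p5, h.p6, h.p7, h.p8, h.p9, h.p10⟩,
    fun ⟨⟨h1, h2⟩, h3, h4, h5, h6, h7, h8, h9, h10⟩ => ⟨h1, h2, h3, h4, h5, h6, h7, h8, h9, h10⟩⟩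

/-- **Proposition 1 (51), AS TYPED (`B7.Prop1Printed`), for the concrete one-step average (42) on `ℤ^d`** — carriers
`B7Prop1Explicit.concreteOneStep 𝔸 L` (index = the plaquettes `p′` of the `L`-lattice; configurations with values in
`U1 𝔸`, `𝔸` any complete normed `ℂ`-algebra with `‖1‖ = 1`; hypothesis (44) over ALL unit plaquettes of `ℤ^d`),
every `d`, every `L ≥ 1`: the b07 lineage's theorem, by name (witnesses `C₀ = 14464(d+1)²(d+4)²`,
`c₂′ = 1/(512(d+1)(d+4)L²)`). [cite: Balaban1985Averaging, Prop. 1 (51) p.26 (kernel version for the typed concrete carriers of …B7Prop1Explicit; proof the package's)] -/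
theorem prop1Printed_concreteOneStep (d L : ℕ) (hL : 1 ≤ L) (𝔸 : Type) [NormedRing 𝔸] [NormOneClass 𝔸]
    [NormedAlgebra ℂ 𝔸] [CompleteSpace 𝔸] :
    B7.Prop1Printed (L : ℝ) (B7Prop1Explicit.concreteOneStep 𝔸 (d := d) L) :=
  B7Prop1Explicit.prop1Printed_concrete L hL

/-- **Proposition 1 (51), AS TYPED, WITH THE PRINTED LOCALITY «(44) for `p ⊂ Δ(p′)`»** — carriers
`B7Prop1Local.concreteOneStepLocal 𝔸 L` (hypothesis (44) only over the plaquettes inside `Δ(p′)` (46)), every `d`,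
every `L ≥ 1`: the b07 lineage's theorem, by name. [cite: Balaban1985Averaging, Prop. 1 (51) p.26, (46) p.25 (kernel version for the typed local concrete carriers of …B7Prop1Local; proof the package's)] -/
theorem prop1Printed_concreteOneStepLocal (d L : ℕ) (hL : 1 ≤ L) (𝔸 : Type) [NormedRing 𝔸] [NormOneClass 𝔸]
    [NormedAlgebra ℂ 𝔸] [CompleteSpace 𝔸] :
    B7.Prop1Printed (L : ℝ) (B7Prop1Local.concreteOneStepLocal 𝔸 (d := d) L) :=
  B7Prop1Local.prop1Printed_concrete_local L hL

/-- **Proposition 2 (52)–(54), AS TYPED (`B7.Prop2Printed`), for the concrete `k`-fold average (43) on `ℤ^d`** —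
carriers `fun k => B7Prop2Explicit.concreteKStep d 𝔸 G L k` (index `k : ℕ`; `G`-valued configurations, `G` any
`AvgClosed` subgroup of `𝔸ˣ`; hypothesis (52) over ALL plaquettes), `L ≥ 2`, with the constants
`B7Prop2Explicit.C0 d = 14464(d+1)²(d+4)²`, `B7Prop2Explicit.c2' d L = 1/(512(d+1)(d+4)L²)` and
`c₂ = min{1/(3C₀), ½c₂′}` exactly as printed: the b07 lineage's theorem, by name. [cite: Balaban1985Averaging, Prop. 2 (52)–(54) p.26 (kernel version for the typed concrete carriers of …B7Prop2Explicit; proof the package's)] -/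
theorem prop2Printed_concreteKStep (d L : ℕ) (hL : 2 ≤ L) (𝔸 : Type) [NormedRing 𝔸] [NormOneClass 𝔸]
    [NormedAlgebra ℂ 𝔸] [CompleteSpace 𝔸] {G : Subgroup 𝔸ˣ} (hG : B7Prop2Explicit.AvgClosed d L G) :
    B7.Prop2Printed (B7Prop2Explicit.C0 d) (B7Prop2Explicit.c2' d L)
      (fun k : ℕ => B7Prop2Explicit.concreteKStep d 𝔸 G L k) :=
  B7Prop2Explicit.prop2Printed_concrete L hL hG

/-- **Proposition 2 (52)–(54), AS TYPED, WITH THE PRINTED LOCALITY** «enough to assume (52) for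
`p ⊂ B^k(x) ∪ B^k(y) ∪ B^k(z) ∪ B^k(w)`» (p. 26) — carriers `B7Prop1Local.concreteKStepLocal d 𝔸 G L` (index
`(k, z, μ, ν)` = a plaquette of the `k`-th lattice; hypothesis (52) on the four `k`-blocks at its corners only),
`L ≥ 2`, `G` any `AvgClosed` subgroup, same constants: the b07 lineage's theorem, by name. [cite: Balaban1985Averaging, Prop. 2 (52)–(54) p.26 with the locality remark p.26 (kernel version for the typed local concrete carriers of …B7Prop1Local; proof the package's)] -/
theorem prop2Printed_concreteKStepLocal (d L : ℕ) (hL : 2 ≤ L) (𝔸 : Type) [NormedRing 𝔸] [NormOneClass 𝔸]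
    [NormedAlgebra ℂ 𝔸] [CompleteSpace 𝔸] {G : Subgroup 𝔸ˣ} (hG : B7Prop2Explicit.AvgClosed d L G) :
    B7.Prop2Printed (B7Prop2Explicit.C0 d) (B7Prop2Explicit.c2' d L) (B7Prop1Local.concreteKStepLocal d 𝔸 G L) :=
  B7Prop1Local.prop2Printed_concrete_local L hL hG

open scoped Matrix.Norms.L2Operator in
/-- The PRINTED SETTING as an instance of the typeclass package: `G = U(N) ⊂ M_N(ℂ)`, `N ≥ 1`, with the operator
norm (19) — Proposition 2 for the `k`-fold average (43) of `U(N)`-valued configurations on `ℤ^d`, both hypothesis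
regions (all plaquettes ∕ the four corner blocks), by name. [cite: Balaban1985Averaging, Prop. 2 (52)–(54) p.26 (kernel versions for U(N), …B7Prop2Explicit and …B7Prop1Local)] -/
theorem prop2Printed_unitaryGroup_two_regions (d : ℕ) (N : ℕ) [NeZero N] (L : ℕ) (hL : 2 ≤ L) :
    B7.Prop2Printed (B7Prop2Explicit.C0 d) (B7Prop2Explicit.c2' d L)
        (fun k : ℕ => B7Prop2Explicit.concreteKStep d (Matrix (Fin N) (Fin N) ℂ)
          (B7Prop2Explicit.unitaryUnits (Matrix (Fin N) (Fin N) ℂ)) L k) ∧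
      B7.Prop2Printed (B7Prop2Explicit.C0 d) (B7Prop2Explicit.c2' d L)
        (B7Prop1Local.concreteKStepLocal d (Matrix (Fin N) (Fin N) ℂ)
          (B7Prop2Explicit.unitaryUnits (Matrix (Fin N) (Fin N) ℂ)) L) :=
  ⟨B7Prop2Explicit.prop2Printed_unitaryGroup N L hL, B7Prop1Local.prop2Printed_unitaryGroup_local N L hL⟩

/-- **Conjuncts `p1` ∧ `p2` of leaf `b7` are theorems of the package for TWO concrete carrier pairs** (global
hypothesis region ∕ printed locality), every `d`, every `L ≥ 2`, every complete normed `ℂ`-algebra `𝔸` with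
`‖1‖ = 1` and every `AvgClosed` gauge group `G ≤ 𝔸ˣ`. [cite: Balaban1985Averaging, Prop. 1 (51), Prop. 2 (52)–(54) p.26 (kernel versions for the typed concrete carriers of …B7Prop1Explicit, …B7Prop2Explicit, …B7Prop1Local)] -/
theorem leafB7_p12_two_families (d L : ℕ) (hL : 2 ≤ L) (𝔸 : Type) [NormedRing 𝔸] [NormOneClass 𝔸]
    [NormedAlgebra ℂ 𝔸] [CompleteSpace 𝔸] {G : Subgroup 𝔸ˣ} (hG : B7Prop2Explicit.AvgClosed d L G) :
    (B7.Prop1Printed (L : ℝ) (B7Prop1Explicit.concreteOneStep 𝔸 (d := d) L) ∧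
      B7.Prop2Printed (B7Prop2Explicit.C0 d) (B7Prop2Explicit.c2' d L)
        (fun k : ℕ => B7Prop2Explicit.concreteKStep d 𝔸 G L k)) ∧
    (B7.Prop1Printed (L : ℝ) (B7Prop1Local.concreteOneStepLocal 𝔸 (d := d) L) ∧
      B7.Prop2Printed (B7Prop2Explicit.C0 d) (B7Prop2Explicit.c2' d L)
        (B7Prop1Local.concreteKStepLocal d 𝔸 G L)) :=
  ⟨⟨prop1Printed_concreteOneStep d L (by omega) 𝔸, prop2Printed_concreteKStep d L hL 𝔸 hG⟩,
    ⟨prop1Printed_concreteOneStepLocal d L (by omega) 𝔸, prop2Printed_concreteKStepLocal d L hL 𝔸 hG⟩⟩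

/-- Binding carriers whose B7 one-step ∕ `k`-step averaging data ARE the concrete averages (42) ∕ (43) on `ℤ^d` of
`…B7Prop1Explicit` ∕ `…B7Prop2Explicit` (global hypothesis region), with the leaf's `L`, `C₀`, `c₂′` set to the block
size `L` and the lineage's witnesses `C0 d`, `c2' d L`; every other carrier — in particular `c₂` and the Prop. 3–10
data `kexp7`, `gd7`, `gone7` — unchanged. [folklore] -/
noncomputable def _root_.Literature.MathematicalPhysics.QuantumFieldTheory.Balaban1983to89.DagBinding.PrintedCarriersR.withConcreteAvg
    (X : PrintedCarriersR) (d L : ℕ) (𝔸 : Type) [NormedRing 𝔸] [NormOneClass 𝔸] [NormedAlgebra ℂ 𝔸]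
    [CompleteSpace 𝔸] (G : Subgroup 𝔸ˣ) : PrintedCarriersR :=
  { X with
    I7a := {p : B7Prop1Explicit.Site d × Fin d × Fin d // p.2.1 ≠ p.2.2}
    one7 := B7Prop1Explicit.concreteOneStep 𝔸 (d := d) L
    I7b := ℕ
    kst7 := fun k : ℕ => B7Prop2Explicit.concreteKStep d 𝔸 G L k
    L7 := (L : ℝ)
    C₀ := B7Prop2Explicit.C0 d
    c₂' := B7Prop2Explicit.c2' d L }

/-- The same with the PRINTED-LOCALITY carriers of `…B7Prop1Local` (`k`-step index `(k, z, μ, ν)`). [folklore] -/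
noncomputable def _root_.Literature.MathematicalPhysics.QuantumFieldTheory.Balaban1983to89.DagBinding.PrintedCarriersR.withConcreteAvgLocal
    (X : PrintedCarriersR) (d L : ℕ) (𝔸 : Type) [NormedRing 𝔸] [NormOneClass 𝔸] [NormedAlgebra ℂ 𝔸]
    [CompleteSpace 𝔸] (G : Subgroup 𝔸ˣ) : PrintedCarriersR :=
  { X with
    I7a := {p : B7Prop1Explicit.Site d × Fin d × Fin d // p.2.1 ≠ p.2.2}
    one7 := B7Prop1Local.concreteOneStepLocal 𝔸 (d := d) L
    I7b := ℕ × B7Prop1Explicit.Site d × Fin d × Fin d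
    kst7 := B7Prop1Local.concreteKStepLocal d 𝔸 G L
    L7 := (L : ℝ)
    C₀ := B7Prop2Explicit.C0 d
    c₂' := B7Prop2Explicit.c2' d L }

/-- Bookkeeping (`rfl`): the substituted carriers carry the concrete averaging data and constants; `c₂` and the
Prop. 3–10 carriers are the original ones. [folklore] -/
theorem withConcreteAvg_fields (X : PrintedCarriersR) (d L : ℕ) (𝔸 : Type) [NormedRing 𝔸] [NormOneClass 𝔸]
    [NormedAlgebra ℂ 𝔸] [CompleteSpace 𝔸] (G : Subgroup 𝔸ˣ) :
    (X.withConcreteAvg d L 𝔸 G).one7 = B7Prop1Explicit.concreteOneStep 𝔸 (d := d) L ∧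
      (X.withConcreteAvg d L 𝔸 G).kst7 = (fun k : ℕ => B7Prop2Explicit.concreteKStep d 𝔸 G L k) ∧
      (X.withConcreteAvg d L 𝔸 G).L7 = (L : ℝ) ∧ (X.withConcreteAvg d L 𝔸 G).C₀ = B7Prop2Explicit.C0 d ∧
      (X.withConcreteAvg d L 𝔸 G).c₂' = B7Prop2Explicit.c2' d L ∧ (X.withConcreteAvg d L 𝔸 G).c₂ = X.c₂ ∧
      (X.withConcreteAvgLocal d L 𝔸 G).one7 = B7Prop1Local.concreteOneStepLocal 𝔸 (d := d) L ∧
      (X.withConcreteAvgLocal d L 𝔸 G).kst7 = B7Prop1Local.concreteKStepLocal d 𝔸 G L ∧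
      (X.withConcreteAvgLocal d L 𝔸 G).L7 = (L : ℝ) ∧ (X.withConcreteAvgLocal d L 𝔸 G).c₂ = X.c₂ :=
  ⟨rfl, rfl, rfl, rfl, rfl, rfl, rfl, rfl, rfl, rfl⟩

/-- **For the concrete averaging carriers (global region) leaf `b7` is EQUIVALENT to its quoted rest** —
Propositions 1 and 2 need no quotation (`L ≥ 2`, `G` `AvgClosed`). [cite: Balaban1985Averaging, Props. 1–2 p.26 (proved for the typed concrete carriers); Props. 3–10 pp.36–50 (quoted)] -/
theorem b7_withConcreteAvg_iff (X : PrintedCarriersR) (d L : ℕ) (hL : 2 ≤ L) (𝔸 : Type) [NormedRing 𝔸]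
    [NormOneClass 𝔸] [NormedAlgebra ℂ 𝔸] [CompleteSpace 𝔸] {G : Subgroup 𝔸ˣ}
    (hG : B7Prop2Explicit.AvgClosed d L G) :
    B7.Concl (X.withConcreteAvg d L 𝔸 G).L7 (X.withConcreteAvg d L 𝔸 G).c₂ (X.withConcreteAvg d L 𝔸 G).C₀
        (X.withConcreteAvg d L 𝔸 G).c₂' (X.withConcreteAvg d L 𝔸 G).one7 (X.withConcreteAvg d L 𝔸 G).kst7
        (X.withConcreteAvg d L 𝔸 G).kexp7 (X.withConcreteAvg d L 𝔸 G).gd7 (X.withConcreteAvg d L 𝔸 G).gone7 ↔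
      B7LeafRest (L : ℝ) X.c₂ (B7Prop1Explicit.concreteOneStep 𝔸 (d := d) L) X.kexp7 X.gd7 X.gone7 := by
  rw [b7Concl_iff_p12_and_rest]
  exact ⟨fun h => h.2, fun h => ⟨(leafB7_p12_two_families d L hL 𝔸 hG).1, h⟩⟩

/-- **The same for the printed-locality carriers.** [cite: Balaban1985Averaging, Props. 1–2 p.26 (proved for the typed local concrete carriers); Props. 3–10 pp.36–50 (quoted)] -/
theorem b7_withConcreteAvgLocal_iff (X : PrintedCarriersR) (d L : ℕ) (hL : 2 ≤ L) (𝔸 : Type) [NormedRing 𝔸]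
    [NormOneClass 𝔸] [NormedAlgebra ℂ 𝔸] [CompleteSpace 𝔸] {G : Subgroup 𝔸ˣ}
    (hG : B7Prop2Explicit.AvgClosed d L G) :
    B7.Concl (X.withConcreteAvgLocal d L 𝔸 G).L7 (X.withConcreteAvgLocal d L 𝔸 G).c₂
        (X.withConcreteAvgLocal d L 𝔸 G).C₀ (X.withConcreteAvgLocal d L 𝔸 G).c₂'
        (X.withConcreteAvgLocal d L 𝔸 G).one7 (X.withConcreteAvgLocal d L 𝔸 G).kst7
        (X.withConcreteAvgLocal d L 𝔸 G).kexp7 (X.withConcreteAvgLocal d L 𝔸 G).gd7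
        (X.withConcreteAvgLocal d L 𝔸 G).gone7 ↔
      B7LeafRest (L : ℝ) X.c₂ (B7Prop1Local.concreteOneStepLocal 𝔸 (d := d) L) X.kexp7 X.gd7 X.gone7 := by
  rw [b7Concl_iff_p12_and_rest]
  exact ⟨fun h => h.2, fun h => ⟨(leafB7_p12_two_families d L hL 𝔸 hG).2, h⟩⟩

/-- **Leaf `b7` of the current P-binding, for carriers with the concrete averaging data (global region), is
EQUIVALENT to the eight quoted statements Props. 3–10** (`B7LeafRest` over the carriers' own Prop. 3–10 data, the
Prop. 3 carrier being the concrete one-step family). [cite: Balaban1985Averaging, Props. 1–2 p.26 (proved for the typed concrete carriers); Props. 3–10 pp.36–50 (quoted)] -/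
theorem ofPrintedAllXP_withConcreteAvg_b7_iff (X : PrintedCarriersR) (Y : PrintedCarriers9X) (Z : PrintedCarriers11)
    (V : PrintedCarriers14R) (W : PrintedCarriers15) (d L : ℕ) (hL : 2 ≤ L) (𝔸 : Type) [NormedRing 𝔸]
    [NormOneClass 𝔸] [NormedAlgebra ℂ 𝔸] [CompleteSpace 𝔸] {G : Subgroup 𝔸ˣ}
    (hG : B7Prop2Explicit.AvgClosed d L G) :
    (Upstream.ofPrintedAllXP (X.withConcreteAvg d L 𝔸 G) Y Z V W).b7 ↔
      B7LeafRest (L : ℝ) X.c₂ (B7Prop1Explicit.concreteOneStep 𝔸 (d := d) L) X.kexp7 X.gd7 X.gone7 :=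
  b7_withConcreteAvg_iff X d L hL 𝔸 hG

/-- The quoted statements give that leaf. [cite: Balaban1985Averaging, Props. 3–10 pp.36–50 (quoted)] -/
theorem ofPrintedAllXP_withConcreteAvg_b7_of_rest (X : PrintedCarriersR) (Y : PrintedCarriers9X)
    (Z : PrintedCarriers11) (V : PrintedCarriers14R) (W : PrintedCarriers15) (d L : ℕ) (hL : 2 ≤ L) (𝔸 : Type)
    [NormedRing 𝔸] [NormOneClass 𝔸] [NormedAlgebra ℂ 𝔸] [CompleteSpace 𝔸] {G : Subgroup 𝔸ˣ}
    (hG : B7Prop2Explicit.AvgClosed d L G)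
    (h : B7LeafRest (L : ℝ) X.c₂ (B7Prop1Explicit.concreteOneStep 𝔸 (d := d) L) X.kexp7 X.gd7 X.gone7) :
    (Upstream.ofPrintedAllXP (X.withConcreteAvg d L 𝔸 G) Y Z V W).b7 :=
  (ofPrintedAllXP_withConcreteAvg_b7_iff X Y Z V W d L hL 𝔸 hG).2 h

/-- **The same for the printed-locality carriers.** [cite: Balaban1985Averaging, Props. 1–2 p.26 (proved for the typed local concrete carriers); Props. 3–10 pp.36–50 (quoted)] -/
theorem ofPrintedAllXP_withConcreteAvgLocal_b7_iff (X : PrintedCarriersR) (Y : PrintedCarriers9X)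
    (Z : PrintedCarriers11) (V : PrintedCarriers14R) (W : PrintedCarriers15) (d L : ℕ) (hL : 2 ≤ L) (𝔸 : Type)
    [NormedRing 𝔸] [NormOneClass 𝔸] [NormedAlgebra ℂ 𝔸] [CompleteSpace 𝔸] {G : Subgroup 𝔸ˣ}
    (hG : B7Prop2Explicit.AvgClosed d L G) :
    (Upstream.ofPrintedAllXP (X.withConcreteAvgLocal d L 𝔸 G) Y Z V W).b7 ↔
      B7LeafRest (L : ℝ) X.c₂ (B7Prop1Local.concreteOneStepLocal 𝔸 (d := d) L) X.kexp7 X.gd7 X.gone7 :=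
  b7_withConcreteAvgLocal_iff X d L hL 𝔸 hG

/-- The quoted statements give that leaf (printed-locality carriers). [cite: Balaban1985Averaging, Props. 3–10 pp.36–50 (quoted)] -/
theorem ofPrintedAllXP_withConcreteAvgLocal_b7_of_rest (X : PrintedCarriersR) (Y : PrintedCarriers9X)
    (Z : PrintedCarriers11) (V : PrintedCarriers14R) (W : PrintedCarriers15) (d L : ℕ) (hL : 2 ≤ L) (𝔸 : Type)
    [NormedRing 𝔸] [NormOneClass 𝔸] [NormedAlgebra ℂ 𝔸] [CompleteSpace 𝔸] {G : Subgroup 𝔸ˣ}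
    (hG : B7Prop2Explicit.AvgClosed d L G)
    (h : B7LeafRest (L : ℝ) X.c₂ (B7Prop1Local.concreteOneStepLocal 𝔸 (d := d) L) X.kexp7 X.gd7 X.gone7) :
    (Upstream.ofPrintedAllXP (X.withConcreteAvgLocal d L 𝔸 G) Y Z V W).b7 :=
  (ofPrintedAllXP_withConcreteAvgLocal_b7_iff X Y Z V W d L hL 𝔸 hG).2 h

/-- The same at the K-binding of `…DagDischarged` v3 (its `b7` field is the P-binding's), every κ, both carrier
pairs. [cite: Balaban1985Averaging, Props. 1–2 p.26 (proved for the typed concrete carriers); Props. 3–10 pp.36–50 (quoted)] -/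
theorem ofPrintedAllXPK_withConcreteAvg_b7_iff (X : PrintedCarriersR) (Y : PrintedCarriers9X)
    (Z : PrintedCarriers11) (V : PrintedCarriers14R) (W : PrintedCarriers15) (κ : ℝ) (d L : ℕ) (hL : 2 ≤ L)
    (𝔸 : Type) [NormedRing 𝔸] [NormOneClass 𝔸] [NormedAlgebra ℂ 𝔸] [CompleteSpace 𝔸] {G : Subgroup 𝔸ˣ}
    (hG : B7Prop2Explicit.AvgClosed d L G) :
    ((Upstream.ofPrintedAllXPK (X.withConcreteAvg d L 𝔸 G) Y Z V W κ).b7 ↔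
      B7LeafRest (L : ℝ) X.c₂ (B7Prop1Explicit.concreteOneStep 𝔸 (d := d) L) X.kexp7 X.gd7 X.gone7) ∧
    ((Upstream.ofPrintedAllXPK (X.withConcreteAvgLocal d L 𝔸 G) Y Z V W κ).b7 ↔
      B7LeafRest (L : ℝ) X.c₂ (B7Prop1Local.concreteOneStepLocal 𝔸 (d := d) L) X.kexp7 X.gd7 X.gone7) :=
  ⟨b7_withConcreteAvg_iff X d L hL 𝔸 hG, b7_withConcreteAvgLocal_iff X d L hL 𝔸 hG⟩

/-- **VACUITY WITNESS — NOT a discharge of Proposition 3.**  The concrete one-step carriers of the b07 lineage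
carry TRIVIAL Prop. 3 fields (`Fld := Unit`, `fldNorm := 0`, `IsAnalyticQ := True`, `remC := 0`: the modules treat
Props. 1–2 only, their HONEST SCOPE (e) ∕ (f)), so over them the typed `B7.Prop3Printed L c₂` holds for every
`c₂ > 0` by `0 ≤ 0` — it says NOTHING about the analyticity of `Q(V₀, A)` or the remainder bound (123).  The
genuine carrier of Prop. 3 is the (121)–(123) data at CURVED backgrounds `V₀` — in the tree so far only its flat-background
rung `V₀ = 1` for the concrete average (42), `…B7Prop3Flat` (b07 lineage, cell node B7-PROP3-FLAT; a first rung, not a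
carrier of the leaf's `one7`, not bound here); in this section Prop. 3 is QUOTED as a conjunct of `B7LeafRest`, and this
theorem only makes explicit that, over these carriers, that conjunct is contentless. [folklore] -/
theorem prop3Printed_concreteOneStep_vacuous (d L : ℕ) (𝔸 : Type) [NormedRing 𝔸] [NormOneClass 𝔸]
    [NormedAlgebra ℂ 𝔸] [CompleteSpace 𝔸] {c₂ : ℝ} (hc : 0 < c₂) :
    B7.Prop3Printed (L : ℝ) c₂ (B7Prop1Explicit.concreteOneStep 𝔸 (d := d) L) ∧
      B7.Prop3Printed (L : ℝ) c₂ (B7Prop1Local.concreteOneStepLocal 𝔸 (d := d) L) := by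
  refine ⟨⟨1, c₂, one_pos, hc, le_rfl, ?_⟩, ⟨1, c₂, one_pos, hc, le_rfl, ?_⟩⟩ <;>
  · intro i α₀ α₁ _ _ _ _ V _
    refine ⟨trivial, ?_⟩
    intro A _
    show (0 : ℝ) ≤ 1 * (L : ℝ) ^ 2 * (0 : ℝ) ^ 2
    positivity

/-- Consequently (honest reading of what stays quoted WITH CONTENT): for the printed-locality carriers and
`c₂ > 0`, leaf `b7` of the P-binding is EQUIVALENT to Propositions 4–10 over the leaf's `k`-fold-expansion and
gauge carriers — Props. 1–2 proved, Prop. 3 vacuous over these one-step carriers (NOT Prop. 3 of the paper),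
Props. 4–10 quoted. [cite: Balaban1985Averaging, Props. 1–2 p.26 (proved for the typed local concrete carriers); Prop. 4 pp.38–39, Prop. 5 p.42, Props. 6–7 p.43, Prop. 8 p.45, Prop. 9 p.49, Prop. 10 p.50 (quoted)] -/
theorem ofPrintedAllXP_withConcreteAvgLocal_b7_iff_props4to10 (X : PrintedCarriersR) (Y : PrintedCarriers9X)
    (Z : PrintedCarriers11) (V : PrintedCarriers14R) (W : PrintedCarriers15) (d L : ℕ) (hL : 2 ≤ L) (𝔸 : Type)
    [NormedRing 𝔸] [NormOneClass 𝔸] [NormedAlgebra ℂ 𝔸] [CompleteSpace 𝔸] {G : Subgroup 𝔸ˣ}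
    (hG : B7Prop2Explicit.AvgClosed d L G) (hc₂ : 0 < X.c₂) :
    (Upstream.ofPrintedAllXP (X.withConcreteAvgLocal d L 𝔸 G) Y Z V W).b7 ↔
      B7.Prop4Printed X.kexp7 ∧ B7.Prop5Printed X.kexp7 ∧ B7.Prop6Printed X.kexp7 ∧ B7.Prop7Printed X.kexp7 ∧
        B7.Prop8Printed X.gd7 ∧ B7.Prop9Printed (L : ℝ) X.gone7 ∧ B7.Prop10Printed X.gd7 := by
  rw [ofPrintedAllXP_withConcreteAvgLocal_b7_iff X Y Z V W d L hL 𝔸 hG]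
  exact ⟨fun h => h.2, fun h => ⟨(prop3Printed_concreteOneStep_vacuous d L 𝔸 hc₂).2, h⟩⟩

end LeafB7Prop12Concrete

/-! ## Leaf `b4`, conjunct 1 — Theorem p. 573 (1.9)–(1.12): the typed transcription (literal «∀ α < 1») REFUTED AS TYPED on the zero-field carriers (node 16), its `0 ≤ α` restriction (node 13's `ThmPrintedNN`) bound as `B4LeafNN` ∕ `Upstream.ofPrintedAllXPN` and DISCHARGED on the zero-field nested-box family (v4) -/

section LeafB4ThmNN

/-! ### Plumbing: re-binding one leaf of an upstream bundle -/

/-- Re-binding ONE leaf: the upstream `u` with its `b4` slot replaced by the proposition `b4` (all other leaves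
unchanged, `rfl`).  Prop-generic plumbing. [folklore] -/
def _root_.Literature.MathematicalPhysics.QuantumFieldTheory.Balaban1983to89.DagBinding.Upstream.withB4
    (u : Upstream) (b4 : Prop) : Upstream :=
  { u with b4 := b4 }

/-- Bookkeeping (`rfl`): the re-bound leaf and the untouched ones. [folklore] -/
theorem withB4_leaves (u : Upstream) (b4 : Prop) :
    (u.withB4 b4).b4 = b4 ∧ (u.withB4 b4).b5 = u.b5 ∧ (u.withB4 b4).b6 = u.b6 ∧ (u.withB4 b4).b7 = u.b7 ∧
    (u.withB4 b4).b8 = u.b8 ∧ (u.withB4 b4).b9 = u.b9 ∧ (u.withB4 b4).b10 = u.b10 ∧ (u.withB4 b4).b11 = u.b11 ∧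
    (u.withB4 b4).b12 = u.b12 ∧ (u.withB4 b4).b13 = u.b13 ∧ (u.withB4 b4).rOperation = u.rOperation ∧
    (u.withB4 b4).rBasicStep = u.rBasicStep :=
  ⟨rfl, rfl, rfl, rfl, rfl, rfl, rfl, rfl, rfl, rfl, rfl, rfl⟩

/-! ### The `b4` leaf with conjunct 1 in its `0 ≤ α` restriction (node 13's `ThmPrintedNN`, by name) -/

/-- **B4's leaf with conjunct 1 restricted to `0 ≤ α`**: node 13's `B4Ineq111ZeroNestEta.ThmPrintedNN famE` (the body
of the typed leaf conjunct `B4.ThmPrinted famE` verbatim with the one binder `0 ≤ α` added — used BY NAME, not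
restated) ∧ «Proposition 2.3 of [1]» ∧ «Proposition 3.1′ of [2]» ∧ the Sect. 5 Theorem — the last three conjuncts
verbatim those of `B4.LeafB4`. [cite: Balaban1983RegularityDecay, Theorem p. 573 (1.9)–(1.12), transcription of the typed leaf `B4.ThmPrinted` restricted to 0 ≤ α (print: «For α<1»); Props. 2.3 ∕ 3.1′ p. 574, Sect. 5 Theorem p. 594 (quoted)] -/
def B4LeafNN {I₁ I₂ I₃ : Type} (famE : I₁ → B4.EtaSetting) (famU : I₂ → B4.UnitSetting)
    (famF : I₃ → B4.FormSetting) (d N : ℕ) : Prop :=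
  B4Ineq111ZeroNestEta.ThmPrintedNN famE ∧ B4.Prop23Printed famU ∧ B4.Prop31Printed famF ∧ B4.Sect5ThmUniform d N

/-- Assembling the NN leaf from its four statements. [folklore] -/
theorem b4LeafNN_intro {I₁ I₂ I₃ : Type} {famE : I₁ → B4.EtaSetting} {famU : I₂ → B4.UnitSetting}
    {famF : I₃ → B4.FormSetting} {d N : ℕ} (h₁ : B4Ineq111ZeroNestEta.ThmPrintedNN famE)
    (h₂ : B4.Prop23Printed famU) (h₃ : B4.Prop31Printed famF) (h₄ : B4.Sect5ThmUniform d N) :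
    B4LeafNN famE famU famF d N :=
  ⟨h₁, h₂, h₃, h₄⟩

/-- The NN leaf unfolded (`Iff.rfl`). [folklore] -/
theorem b4LeafNN_iff {I₁ I₂ I₃ : Type} (famE : I₁ → B4.EtaSetting) (famU : I₂ → B4.UnitSetting)
    (famF : I₃ → B4.FormSetting) (d N : ℕ) :
    B4LeafNN famE famU famF d N ↔ B4Ineq111ZeroNestEta.ThmPrintedNN famE ∧ B4.Prop23Printed famU ∧
      B4.Prop31Printed famF ∧ B4.Sect5ThmUniform d N :=
  Iff.rfl

/-- The TYPED leaf implies the NN leaf (node 13's `thmPrintedNN_of_thmPrinted`, by name) — never conversely: for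
α < 0 the typed conjunct is refuted on b04's zero-field carriers (node 16, below). [folklore] -/
theorem b4LeafNN_of_leafB4 {I₁ I₂ I₃ : Type} {famE : I₁ → B4.EtaSetting} {famU : I₂ → B4.UnitSetting}
    {famF : I₃ → B4.FormSetting} {d N : ℕ} (h : B4.LeafB4 famE famU famF d N) : B4LeafNN famE famU famF d N :=
  ⟨B4Ineq111ZeroNestEta.thmPrintedNN_of_thmPrinted famE h.1, h.2.1, h.2.2.1, h.2.2.2⟩

/-- From the NN leaf, the Sect. 5 Theorem in its literal printed reading (`B4.sect5_literal_of_uniform`). [cite: Balaban1983RegularityDecay, Sect. 5 Theorem p. 594] -/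
theorem b4LeafNN_sect5_literal {I₁ I₂ I₃ : Type} {famE : I₁ → B4.EtaSetting} {famU : I₂ → B4.UnitSetting}
    {famF : I₃ → B4.FormSetting} {d N : ℕ} (h : B4LeafNN famE famU famF d N) : B4.Sect5ThmLiteral d N :=
  B4.sect5_literal_of_uniform h.2.2.2

/-! ### The re-bound upstream `Upstream.ofPrintedAllXPN` -/

/-- **The parameter-free binding with the B4 leaf in NN form** (and the B6 leaf in parameter form, `…DagBinding`
§(v8b)): `Upstream.ofPrintedAllXP` with `b4 := B4LeafNN X.famE X.famU X.famF X.d4 X.N4`. [cite: Balaban1983RegularityDecay, Theorem p. 573 (1.9)–(1.12), transcription of the typed leaf `B4.ThmPrinted` restricted to 0 ≤ α (print: «For α<1»)] -/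
def _root_.Literature.MathematicalPhysics.QuantumFieldTheory.Balaban1983to89.DagBinding.Upstream.ofPrintedAllXPN
    (X : PrintedCarriersR) (Y : PrintedCarriers9X) (Z : PrintedCarriers11) (V : PrintedCarriers14R)
    (W : PrintedCarriers15) : Upstream :=
  (Upstream.ofPrintedAllXP X Y Z V W).withB4 (B4LeafNN X.famE X.famU X.famF X.d4 X.N4)

/-- Bookkeeping (`rfl`): the leaves of the N-binding — `b4` is the NN leaf, `b6` the parameter-form block, every other
leaf is the X-binding's. [folklore] -/
theorem ofPrintedAllXPN_leaves (X : PrintedCarriersR) (Y : PrintedCarriers9X) (Z : PrintedCarriers11)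
    (V : PrintedCarriers14R) (W : PrintedCarriers15) :
    (Upstream.ofPrintedAllXPN X Y Z V W).b4 = B4LeafNN X.famE X.famU X.famF X.d4 X.N4 ∧
    (Upstream.ofPrintedAllXPN X Y Z V W).b5 = (Upstream.ofPrintedAllX X Y Z V W).b5 ∧
    (Upstream.ofPrintedAllXPN X Y Z V W).b6 = B6BlockParam X.D6 ∧
    (Upstream.ofPrintedAllXPN X Y Z V W).b7 = (Upstream.ofPrintedAllX X Y Z V W).b7 ∧
    (Upstream.ofPrintedAllXPN X Y Z V W).b8 = (Upstream.ofPrintedAllX X Y Z V W).b8 ∧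
    (Upstream.ofPrintedAllXPN X Y Z V W).b9 = B9LeafX Y ∧
    (Upstream.ofPrintedAllXPN X Y Z V W).b10 = (Upstream.ofPrintedAllX X Y Z V W).b10 ∧
    (Upstream.ofPrintedAllXPN X Y Z V W).b11 = B11Leaf Z ∧
    (Upstream.ofPrintedAllXPN X Y Z V W).b12 = (Upstream.ofPrintedAllX X Y Z V W).b12 ∧
    (Upstream.ofPrintedAllXPN X Y Z V W).b13 = (Upstream.ofPrintedAllX X Y Z V W).b13 ∧
    (Upstream.ofPrintedAllXPN X Y Z V W).rOperation = ROpLeaf V ∧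
    (Upstream.ofPrintedAllXPN X Y Z V W).rBasicStep = B15Leaf W :=
  ⟨rfl, rfl, rfl, rfl, rfl, rfl, rfl, rfl, rfl, rfl, rfl, rfl⟩

/-- The `b4` leaf of the N-binding unfolded (`Iff.rfl`). [folklore] -/
theorem ofPrintedAllXPN_b4_iff (X : PrintedCarriersR) (Y : PrintedCarriers9X) (Z : PrintedCarriers11)
    (V : PrintedCarriers14R) (W : PrintedCarriers15) :
    (Upstream.ofPrintedAllXPN X Y Z V W).b4 ↔
      B4Ineq111ZeroNestEta.ThmPrintedNN X.famE ∧ B4.Prop23Printed X.famU ∧ B4.Prop31Printed X.famF ∧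
        B4.Sect5ThmUniform X.d4 X.N4 :=
  Iff.rfl

/-- The P-binding's (typed) `b4` leaf implies the N-binding's (never conversely). [folklore] -/
theorem ofPrintedAllXPN_b4_of_ofPrintedAllXP (X : PrintedCarriersR) (Y : PrintedCarriers9X) (Z : PrintedCarriers11)
    (V : PrintedCarriers14R) (W : PrintedCarriers15) (h : (Upstream.ofPrintedAllXP X Y Z V W).b4) :
    (Upstream.ofPrintedAllXPN X Y Z V W).b4 :=
  b4LeafNN_of_leafB4 h

/-- The N-binding's `b4` leaf from its four statements. [folklore] -/
theorem ofPrintedAllXPN_b4_intro (X : PrintedCarriersR) (Y : PrintedCarriers9X) (Z : PrintedCarriers11)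
    (V : PrintedCarriers14R) (W : PrintedCarriers15) (h₁ : B4Ineq111ZeroNestEta.ThmPrintedNN X.famE)
    (h₂ : B4.Prop23Printed X.famU) (h₃ : B4.Prop31Printed X.famF) (h₄ : B4.Sect5ThmUniform X.d4 X.N4) :
    (Upstream.ofPrintedAllXPN X Y Z V W).b4 :=
  b4LeafNN_intro h₁ h₂ h₃ h₄

/-- The N-binding's `b4` leaf still yields the Sect. 5 Theorem in its literal printed reading. [cite: Balaban1983RegularityDecay, Sect. 5 Theorem p. 594] -/
theorem ofPrintedAllXPN_b4_sect5 (X : PrintedCarriersR) (Y : PrintedCarriers9X) (Z : PrintedCarriers11)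
    (V : PrintedCarriers14R) (W : PrintedCarriers15) (h : (Upstream.ofPrintedAllXPN X Y Z V W).b4) :
    B4.Sect5ThmLiteral X.d4 X.N4 :=
  b4LeafNN_sect5_literal h

/-- The N-binding's `b6` leaf is the parameter-form block and still delivers B6's main results (Prop. 2.6 ∧ Cor. 2.8)
for the B9 base (`…DagBinding` §(v8b), by name). [cite: Balaban1984PropagatorsII, p.249] -/
theorem ofPrintedAllXPN_b6_mainResults (X : PrintedCarriersR) (Y : PrintedCarriers9X) (Z : PrintedCarriers11)
    (V : PrintedCarriers14R) (W : PrintedCarriers15) (h : (Upstream.ofPrintedAllXPN X Y Z V W).b6) :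
    B6.MainResults X.D6 :=
  b6BlockParam_mainResults X.D6 h

/-! ### NEGATIVE EDGE (by name, kernel: `…B4Thm19ZeroBoxNegAlpha`, node 16): the TYPED `b4` leaf is FALSE over binding carriers whose η-family is one of b04's zero-field carriers -/

/-- The TYPED leaf `B4.LeafB4` fails whenever its η-family is b04's verbatim zero-field box family `boxFamB`
(`L ≥ 2`, mass window `[0, m²₊]`, `a > 0`, `Mb ≥ 1`, any boundary assignment `g`), whatever the other three families:
node 16's `not_thmPrinted_boxFamB` by name. [folklore] -/
theorem not_leafB4_boxFamB {d ℓ : ℕ} {m2plus : ℝ} (hℓ : 1 ≤ ℓ) (hm2 : 0 ≤ m2plus) {a : ℝ} (ha : 0 < a)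
    {Mb : ℕ} (hMb : 1 ≤ Mb) (g : ∀ i : B4Cor23ZeroEta.ZeroFieldInstance d, (↥i.R → ℝ) → ℝ) {I₂ I₃ : Type}
    (famU : I₂ → B4.UnitSetting) (famF : I₃ → B4.FormSetting) (d₄ N₄ : ℕ) :
    ¬ B4.LeafB4 (B4Ineq19ZeroBoxEta.boxFamB ℓ m2plus a Mb g) famU famF d₄ N₄ :=
  fun h => B4Thm19ZeroBoxNegAlpha.not_thmPrinted_boxFamB hℓ hm2 ha hMb g h.1

/-- … and whenever its η-family is b04's verbatim carrier `zeroFieldSettingB a Mb g` over b04's OWN index type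
`ZeroFieldInstance d` (`a > 0`, `Mb ≥ 1`): node 16's `not_thmPrinted_zeroFieldSettingB` by name. [folklore] -/
theorem not_leafB4_zeroFieldSettingB {d : ℕ} {a : ℝ} (ha : 0 < a) {Mb : ℕ} (hMb : 1 ≤ Mb)
    (g : ∀ i : B4Cor23ZeroEta.ZeroFieldInstance d, (↥i.R → ℝ) → ℝ) {I₂ I₃ : Type}
    (famU : I₂ → B4.UnitSetting) (famF : I₃ → B4.FormSetting) (d₄ N₄ : ℕ) :
    ¬ B4.LeafB4 (B4Cor23ZeroEta.zeroFieldSettingB a Mb g : B4Cor23ZeroEta.ZeroFieldInstance d → B4.EtaSetting)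
        famU famF d₄ N₄ :=
  fun h => B4Thm19ZeroBoxNegAlpha.not_thmPrinted_zeroFieldSettingB ha hMb g h.1

/-- Binding carriers whose B4 η-family (the carriers of Theorem p. 573) IS b04's verbatim zero-field box family
`boxFamB` (index type `B4Ineq19ZeroBoxEta.BoxInst d ℓ m²₊`; every other carrier unchanged). [folklore] -/
noncomputable def _root_.Literature.MathematicalPhysics.QuantumFieldTheory.Balaban1983to89.DagBinding.PrintedCarriersR.withBoxFamE
    (X : PrintedCarriersR) (d ℓ : ℕ) (m2plus a : ℝ) (Mb : ℕ)
    (g : ∀ i : B4Cor23ZeroEta.ZeroFieldInstance d, (↥i.R → ℝ) → ℝ) : PrintedCarriersR :=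
  { X with I4E := B4Ineq19ZeroBoxEta.BoxInst d ℓ m2plus, famE := B4Ineq19ZeroBoxEta.boxFamB ℓ m2plus a Mb g }

/-- Binding carriers whose B4 η-family IS b04's verbatim carrier over b04's own index type `ZeroFieldInstance d`
(every other carrier unchanged). [folklore] -/
noncomputable def _root_.Literature.MathematicalPhysics.QuantumFieldTheory.Balaban1983to89.DagBinding.PrintedCarriersR.withZeroFieldFamE
    (X : PrintedCarriersR) (d : ℕ) (a : ℝ) (Mb : ℕ)
    (g : ∀ i : B4Cor23ZeroEta.ZeroFieldInstance d, (↥i.R → ℝ) → ℝ) : PrintedCarriersR :=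
  { X with I4E := B4Cor23ZeroEta.ZeroFieldInstance d, famE := B4Cor23ZeroEta.zeroFieldSettingB a Mb g }

/-- The `b4` field of the P-binding over `withBoxFamE` carriers IS the typed leaf with that η-family (`rfl`).
[folklore] -/
theorem ofPrintedAllXP_withBoxFamE_b4_eq (X : PrintedCarriersR) (Y : PrintedCarriers9X) (Z : PrintedCarriers11)
    (V : PrintedCarriers14R) (W : PrintedCarriers15) (d ℓ : ℕ) (m2plus a : ℝ) (Mb : ℕ)
    (g : ∀ i : B4Cor23ZeroEta.ZeroFieldInstance d, (↥i.R → ℝ) → ℝ) :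
    (Upstream.ofPrintedAllXP (X.withBoxFamE d ℓ m2plus a Mb g) Y Z V W).b4 =
      B4.LeafB4 (B4Ineq19ZeroBoxEta.boxFamB ℓ m2plus a Mb g) X.famU X.famF X.d4 X.N4 :=
  rfl

/-- The `b4` field of the P-binding over `withZeroFieldFamE` carriers IS the typed leaf with that η-family (`rfl`).
[folklore] -/
theorem ofPrintedAllXP_withZeroFieldFamE_b4_eq (X : PrintedCarriersR) (Y : PrintedCarriers9X)
    (Z : PrintedCarriers11) (V : PrintedCarriers14R) (W : PrintedCarriers15) (d : ℕ) (a : ℝ) (Mb : ℕ)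
    (g : ∀ i : B4Cor23ZeroEta.ZeroFieldInstance d, (↥i.R → ℝ) → ℝ) :
    (Upstream.ofPrintedAllXP (X.withZeroFieldFamE d a Mb g) Y Z V W).b4 =
      B4.LeafB4 (B4Cor23ZeroEta.zeroFieldSettingB a Mb g : B4Cor23ZeroEta.ZeroFieldInstance d → B4.EtaSetting)
        X.famU X.famF X.d4 X.N4 :=
  rfl

/-- **The TYPED `b4` leaf of the P-binding is FALSE over `withBoxFamE` carriers** — the negative edge at binding
level: every bookkeeping implication of the ledgers routed through `(…).b4` is vacuous there. [cite: Balaban1983RegularityDecay, Theorem p. 573, case A = 0 — kernel refutation (node 16) of the literal range «α < 1» of the typed transcription `B4.ThmPrinted`; the print's Hölder range is 0 ≤ α < 1] -/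
theorem not_ofPrintedAllXP_withBoxFamE_b4 (X : PrintedCarriersR) (Y : PrintedCarriers9X) (Z : PrintedCarriers11)
    (V : PrintedCarriers14R) (W : PrintedCarriers15) {d ℓ : ℕ} {m2plus : ℝ} (hℓ : 1 ≤ ℓ) (hm2 : 0 ≤ m2plus)
    {a : ℝ} (ha : 0 < a) {Mb : ℕ} (hMb : 1 ≤ Mb)
    (g : ∀ i : B4Cor23ZeroEta.ZeroFieldInstance d, (↥i.R → ℝ) → ℝ) :
    ¬ (Upstream.ofPrintedAllXP (X.withBoxFamE d ℓ m2plus a Mb g) Y Z V W).b4 := by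
  rw [ofPrintedAllXP_withBoxFamE_b4_eq]
  exact not_leafB4_boxFamB hℓ hm2 ha hMb g X.famU X.famF X.d4 X.N4

/-- **… and FALSE over `withZeroFieldFamE` carriers** (b04's own index type). [cite: Balaban1983RegularityDecay, Theorem p. 573, case A = 0 — kernel refutation (node 16) of the literal range «α < 1» of the typed transcription `B4.ThmPrinted`; the print's Hölder range is 0 ≤ α < 1] -/
theorem not_ofPrintedAllXP_withZeroFieldFamE_b4 (X : PrintedCarriersR) (Y : PrintedCarriers9X)
    (Z : PrintedCarriers11) (V : PrintedCarriers14R) (W : PrintedCarriers15) {d : ℕ} {a : ℝ} (ha : 0 < a)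
    {Mb : ℕ} (hMb : 1 ≤ Mb) (g : ∀ i : B4Cor23ZeroEta.ZeroFieldInstance d, (↥i.R → ℝ) → ℝ) :
    ¬ (Upstream.ofPrintedAllXP (X.withZeroFieldFamE d a Mb g) Y Z V W).b4 := by
  rw [ofPrintedAllXP_withZeroFieldFamE_b4_eq]
  exact not_leafB4_zeroFieldSettingB ha hMb g X.famU X.famF X.d4 X.N4

/-- Consequently the earlier bindings' `b4` leaf fails over these carriers too (they all carry the typed
`B4.LeafB4`; shown for the R-binding `Upstream.ofPrintedR`, whatever its four free leaves). [folklore] -/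
theorem not_ofPrintedR_withBoxFamE_b4 (X : PrintedCarriersR) {d ℓ : ℕ} {m2plus : ℝ} (hℓ : 1 ≤ ℓ)
    (hm2 : 0 ≤ m2plus) {a : ℝ} (ha : 0 < a) {Mb : ℕ} (hMb : 1 ≤ Mb)
    (g : ∀ i : B4Cor23ZeroEta.ZeroFieldInstance d, (↥i.R → ℝ) → ℝ) (b9 b11 rOperation rBasicStep : Prop) :
    ¬ (Upstream.ofPrintedR (X.withBoxFamE d ℓ m2plus a Mb g) b9 b11 rOperation rBasicStep).b4 :=
  not_leafB4_boxFamB hℓ hm2 ha hMb g X.famU X.famF X.d4 X.N4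

/-! ### POSITIVE EDGE (by name, kernel: `…B4Ineq111ZeroNestEta`, node 13): the NN conjunct HOLDS on the zero-field nested-box family, so the NN `b4` leaf is discharged of conjunct 1 there -/

/-- Binding carriers whose B4 η-family IS the zero-field NESTED-BOX family in node 12's bond-convention carrier with
the default boundary assignment (`i ↦ zeroFieldSettingBondStd a Mb i.toZF`, index type
`B4Ineq111ZeroNestEta.NestInst d ℓ m²₊`; every other carrier unchanged). [folklore] -/
noncomputable def _root_.Literature.MathematicalPhysics.QuantumFieldTheory.Balaban1983to89.DagBinding.PrintedCarriersR.withNestFamE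
    (X : PrintedCarriersR) (d ℓ : ℕ) (m2plus a : ℝ) (Mb : ℕ) : PrintedCarriersR :=
  { X with I4E := B4Ineq111ZeroNestEta.NestInst d ℓ m2plus,
           famE := fun i => B4Ineq19ZeroBoxEta.zeroFieldSettingBondStd a Mb i.toZF }

/-- The `b4` field of the N-binding over such carriers IS the NN leaf with that η-family (`rfl`). [folklore] -/
theorem ofPrintedAllXPN_withNestFamE_b4_eq (X : PrintedCarriersR) (Y : PrintedCarriers9X) (Z : PrintedCarriers11)
    (V : PrintedCarriers14R) (W : PrintedCarriers15) (d ℓ : ℕ) (m2plus a : ℝ) (Mb : ℕ) :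
    (Upstream.ofPrintedAllXPN (X.withNestFamE d ℓ m2plus a Mb) Y Z V W).b4 =
      B4LeafNN (fun i : B4Ineq111ZeroNestEta.NestInst d ℓ m2plus =>
        B4Ineq19ZeroBoxEta.zeroFieldSettingBondStd a Mb i.toZF) X.famU X.famF X.d4 X.N4 :=
  rfl

/-- **Leaf `b4` of the N-binding, for carriers with the zero-field nested-box η-family, is EQUIVALENT to the two
QUOTED statements «Prop. 2.3 of [1]» and «Prop. 3.1′ of [2]»** (over the carriers' own `famU`, `famF`): conjunct 1
(node 13's `thmPrintedNN_nestFam_std`, every `d`, `ℓ ≥ 1`, `a > 0`, `m²₊`, `Mb`; its antecedents are met at every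
scale, `B4Ineq111ZeroNestEta.threshold_met`, so the discharge is not vacuous) and conjunct 4 (the Sect. 5 Theorem,
`B4Sect5Proof.sect5ThmUniform_holds`) are theorems of the package there, used BY NAME. [cite: Balaban1983RegularityDecay, Theorem p. 573 (1.9)–(1.12), transcription of the typed leaf restricted to 0 ≤ α, proved at A = 0 on nested boxes; Props. 2.3 ∕ 3.1′ p. 574 (quoted); Sect. 5 Theorem p. 594 (proved)] -/
theorem ofPrintedAllXPN_withNestFamE_b4_iff (X : PrintedCarriersR) (Y : PrintedCarriers9X) (Z : PrintedCarriers11)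
    (V : PrintedCarriers14R) (W : PrintedCarriers15) (d ℓ : ℕ) (hℓ : 1 ≤ ℓ) (m2plus : ℝ) {a : ℝ} (ha : 0 < a)
    (Mb : ℕ) :
    (Upstream.ofPrintedAllXPN (X.withNestFamE d ℓ m2plus a Mb) Y Z V W).b4 ↔
      B4.Prop23Printed X.famU ∧ B4.Prop31Printed X.famF := by
  rw [ofPrintedAllXPN_withNestFamE_b4_eq]
  exact ⟨fun h => ⟨h.2.1, h.2.2.1⟩, fun h =>
    ⟨B4Ineq111ZeroNestEta.thmPrintedNN_nestFam_std hℓ a ha Mb, h.1, h.2,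
      B4Sect5Proof.sect5ThmUniform_holds X.d4 X.N4⟩⟩

/-- **Over ALL-ZERO-FIELD carriers the NN `b4` leaf HOLDS OUTRIGHT**: η-family = the zero-field nested boxes (this
section), unit-lattice family = the zero-field nested regions (v1, `withZeroFieldRegions`), form family = the
zero-field forms (`…DagDischarged` v9, `withZeroFieldForms`) — all four statements of node B4, the first in its
`0 ≤ α` restriction, are then theorems of the package AT `A = 0`, used BY NAME. [cite: Balaban1983RegularityDecay, Theorem p. 573 (transcription restricted to 0 ≤ α), Props. 2.3 ∕ 3.1′ p. 574, Sect. 5 Theorem p. 594 — all proved for the typed zero-field carriers, A = 0] -/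
theorem ofPrintedAllXPN_zeroField_b4 (X : PrintedCarriersR) (Y : PrintedCarriers9X) (Z : PrintedCarriers11)
    (V : PrintedCarriers14R) (W : PrintedCarriers15) (d' : ℕ) {amin' m2max' : ℝ} (hamin' : 0 < amin')
    (hmax' : 0 ≤ m2max') (d₁ ℓ₁ : ℕ) (hℓ₁ : 1 ≤ ℓ₁) {aminus aplus m2plus₁ a2minus a2plus : ℝ} (ha₁ : 0 < aminus)
    (ha2 : 0 < a2minus) (d ℓ : ℕ) (hℓ : 1 ≤ ℓ) (m2plus : ℝ) {a : ℝ} (ha : 0 < a) (Mb : ℕ) :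
    (Upstream.ofPrintedAllXPN
        (((X.withZeroFieldForms d' amin' m2max').withZeroFieldRegions d₁ ℓ₁ aminus aplus m2plus₁ a2minus
            a2plus).withNestFamE d ℓ m2plus a Mb) Y Z V W).b4 :=
  (ofPrintedAllXPN_withNestFamE_b4_iff _ Y Z V W d ℓ hℓ m2plus ha Mb).2
    ⟨prop23Printed_zeroFieldRegions d₁ ℓ₁ hℓ₁ ha₁ ha2, prop31Printed_zeroFieldForms d' hamin' hmax'⟩

/-- NET LEDGER for node `b4`, conjunct 1 — BOTH facts side by side, nothing printed asserted: the TYPED conjunct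
(literal «∀ α < 1») is REFUTED on b04's zero-field box family (node 16) and is discharged nowhere; its `0 ≤ α`
restriction (node 13's `ThmPrintedNN`, the Hölder range every consumer of the Theorem uses) is a THEOREM of the
package on the zero-field nested-box family (node 13). [cite: Balaban1983RegularityDecay, Theorem p. 573 (1.9)–(1.12), case A = 0: typed transcription refuted as typed for α < 0, its 0 ≤ α restriction proved on nested boxes] -/
theorem b4_conj1_typed_refuted_nn_proved {d ℓ : ℕ} {m2plus : ℝ} (hℓ : 1 ≤ ℓ) (hm2 : 0 ≤ m2plus) {a : ℝ}
    (ha : 0 < a) {Mb : ℕ} (hMb : 1 ≤ Mb) (g : ∀ i : B4Cor23ZeroEta.ZeroFieldInstance d, (↥i.R → ℝ) → ℝ) :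
    (¬ B4.ThmPrinted (B4Ineq19ZeroBoxEta.boxFamB ℓ m2plus a Mb g)) ∧
      B4Ineq111ZeroNestEta.ThmPrintedNN (fun i : B4Ineq111ZeroNestEta.NestInst d ℓ m2plus =>
        B4Ineq19ZeroBoxEta.zeroFieldSettingBondStd a Mb i.toZF) :=
  ⟨B4Thm19ZeroBoxNegAlpha.not_thmPrinted_boxFamB hℓ hm2 ha hMb g,
    B4Ineq111ZeroNestEta.thmPrintedNN_nestFam_std hℓ a ha Mb⟩

/-- The same at binding level: over one carrier record `X` re-read with the two zero-field η-families, the TYPED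
`b4` leaf of the P-binding FAILS (box family) while the NN `b4` leaf of the N-binding is EQUIVALENT to the two quoted
Propositions (nested-box family). [folklore] -/
theorem b4_bindings_typed_false_nn_iff (X : PrintedCarriersR) (Y : PrintedCarriers9X) (Z : PrintedCarriers11)
    (V : PrintedCarriers14R) (W : PrintedCarriers15) {d ℓ : ℕ} {m2plus : ℝ} (hℓ : 1 ≤ ℓ) (hm2 : 0 ≤ m2plus)
    {a : ℝ} (ha : 0 < a) {Mb : ℕ} (hMb : 1 ≤ Mb)
    (g : ∀ i : B4Cor23ZeroEta.ZeroFieldInstance d, (↥i.R → ℝ) → ℝ) :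
    (¬ (Upstream.ofPrintedAllXP (X.withBoxFamE d ℓ m2plus a Mb g) Y Z V W).b4) ∧
      ((Upstream.ofPrintedAllXPN (X.withNestFamE d ℓ m2plus a Mb) Y Z V W).b4 ↔
        B4.Prop23Printed X.famU ∧ B4.Prop31Printed X.famF) :=
  ⟨not_ofPrintedAllXP_withBoxFamE_b4 X Y Z V W hℓ hm2 ha hMb g,
    ofPrintedAllXPN_withNestFamE_b4_iff X Y Z V W d ℓ hℓ m2plus ha Mb⟩

end LeafB4ThmNN

/-! ## Leaf `b4`, conjunct 1 in its `0 ≤ α` restriction — the NEGATIVE EDGE on b04's VERBATIM (site-derivative) carriers: the face defect of the unguarded Hölder field, `…B4Ineq112ZeroNestNegFace` (node 17) by name (v5) -/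

section LeafB4NNNegFace

/-! ### Leaf level: the NN leaf FAILS whenever its η-family is one of b04's verbatim carriers -/

/-- The NN leaf `B4LeafNN` FAILS whenever its η-family is b04's verbatim carrier `zeroFieldSettingB a Mb g` over b04's
OWN index type `ZeroFieldInstance d` (`a > 0`, `Mb ≥ 1`, boundary assignment `g ≥ 0`), whatever the other three
families: node 17's `not_thmPrintedNN_zeroFieldSettingB` by name — for every `0 < α < 1` the Hölder clause of
(1.11)·(1.12), read through the SITE forward difference `B4Cor23Zero.fdiff` of the verbatim carrier, has NO constants
on the nested pair `Ω` = one big block ⊂ `Ω₀ = Ω ∪ (Ω + M_b·e_μ)` at large scale (the forward bond at a face point of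
`Ω` leaves `Ω`, so `fdiff` vanishes there while one layer inside it is the inward normal derivative; OBSERVATION
(O-bond) of nodes 12 ∕ 13, a kernel theorem in node 17). [folklore] -/
theorem not_b4LeafNN_zeroFieldSettingB {d : ℕ} {a : ℝ} (ha : 0 < a) {Mb : ℕ} (hMb : 1 ≤ Mb)
    {g : ∀ i : B4Cor23ZeroEta.ZeroFieldInstance d, (↥i.R → ℝ) → ℝ} (hg : ∀ i f, 0 ≤ g i f) {I₂ I₃ : Type}
    (famU : I₂ → B4.UnitSetting) (famF : I₃ → B4.FormSetting) (d₄ N₄ : ℕ) :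
    ¬ B4LeafNN (B4Cor23ZeroEta.zeroFieldSettingB a Mb g : B4Cor23ZeroEta.ZeroFieldInstance d → B4.EtaSetting)
        famU famF d₄ N₄ :=
  fun h => B4Ineq112ZeroNestNegFace.not_thmPrintedNN_zeroFieldSettingB ha hMb hg h.1

/-- … in particular for b04's DEFAULT carrier `zeroFieldSetting a Mb` (boundary assignment `dist_η(supp f, Ω₀∖Ω)`):
node 17's `not_thmPrintedNN_zeroFieldSetting` by name. [folklore] -/
theorem not_b4LeafNN_zeroFieldSetting {d : ℕ} {a : ℝ} (ha : 0 < a) {Mb : ℕ} (hMb : 1 ≤ Mb) {I₂ I₃ : Type}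
    (famU : I₂ → B4.UnitSetting) (famF : I₃ → B4.FormSetting) (d₄ N₄ : ℕ) :
    ¬ B4LeafNN (B4Cor23ZeroEta.zeroFieldSetting a Mb : B4Cor23ZeroEta.ZeroFieldInstance d → B4.EtaSetting)
        famU famF d₄ N₄ :=
  fun h => B4Ineq112ZeroNestNegFace.not_thmPrintedNN_zeroFieldSetting ha hMb h.1

/-- … and whenever its η-family is the zero-field NESTED-BOX family in b04's verbatim carrier, `nestFamB` (`L ≥ 2`,
mass window `[0, m²₊]`, `a > 0`, `Mb ≥ 1`, `g ≥ 0`): node 17's `not_thmPrintedNN_nestFamB` by name. [folklore] -/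
theorem not_b4LeafNN_nestFamB {d ℓ : ℕ} {m2plus : ℝ} (hℓ : 1 ≤ ℓ) (hm2 : 0 ≤ m2plus) {a : ℝ} (ha : 0 < a)
    {Mb : ℕ} (hMb : 1 ≤ Mb) {g : ∀ i : B4Cor23ZeroEta.ZeroFieldInstance d, (↥i.R → ℝ) → ℝ} (hg : ∀ i f, 0 ≤ g i f)
    {I₂ I₃ : Type} (famU : I₂ → B4.UnitSetting) (famF : I₃ → B4.FormSetting) (d₄ N₄ : ℕ) :
    ¬ B4LeafNN (B4Ineq111ZeroNestEta.nestFamB (d := d) ℓ m2plus a Mb g) famU famF d₄ N₄ :=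
  fun h => B4Ineq112ZeroNestNegFace.not_thmPrintedNN_nestFamB hℓ hm2 ha hMb hg h.1

/-- … where the TYPED leaf `B4.LeafB4` fails as well (node 17's `not_thmPrinted_nestFamB` by name; typed ⇒ NN).
[folklore] -/
theorem not_leafB4_nestFamB {d ℓ : ℕ} {m2plus : ℝ} (hℓ : 1 ≤ ℓ) (hm2 : 0 ≤ m2plus) {a : ℝ} (ha : 0 < a)
    {Mb : ℕ} (hMb : 1 ≤ Mb) {g : ∀ i : B4Cor23ZeroEta.ZeroFieldInstance d, (↥i.R → ℝ) → ℝ} (hg : ∀ i f, 0 ≤ g i f)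
    {I₂ I₃ : Type} (famU : I₂ → B4.UnitSetting) (famF : I₃ → B4.FormSetting) (d₄ N₄ : ℕ) :
    ¬ B4.LeafB4 (B4Ineq111ZeroNestEta.nestFamB (d := d) ℓ m2plus a Mb g) famU famF d₄ N₄ :=
  fun h => B4Ineq112ZeroNestNegFace.not_thmPrinted_nestFamB hℓ hm2 ha hMb hg h.1

/-! ### Binding level: the NN `b4` leaf of `Upstream.ofPrintedAllXPN` is FALSE over carriers whose η-family is one of b04's verbatim carriers -/

/-- The `b4` field of the N-binding over `withZeroFieldFamE` carriers (v4) IS the NN leaf with b04's verbatim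
η-family (`rfl`). [folklore] -/
theorem ofPrintedAllXPN_withZeroFieldFamE_b4_eq (X : PrintedCarriersR) (Y : PrintedCarriers9X)
    (Z : PrintedCarriers11) (V : PrintedCarriers14R) (W : PrintedCarriers15) (d : ℕ) (a : ℝ) (Mb : ℕ)
    (g : ∀ i : B4Cor23ZeroEta.ZeroFieldInstance d, (↥i.R → ℝ) → ℝ) :
    (Upstream.ofPrintedAllXPN (X.withZeroFieldFamE d a Mb g) Y Z V W).b4 =
      B4LeafNN (B4Cor23ZeroEta.zeroFieldSettingB a Mb g : B4Cor23ZeroEta.ZeroFieldInstance d → B4.EtaSetting)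
        X.famU X.famF X.d4 X.N4 :=
  rfl

/-- **The NN `b4` leaf of the N-binding is FALSE over `withZeroFieldFamE` carriers with `g ≥ 0`** — the negative
edge at binding level for the `0 ≤ α` restriction too: every ledger implication routed through `(…).b4` is vacuous
on such carriers (v4 recorded the same for the TYPED leaf and `α < 0`, node 16). [cite: Balaban1983RegularityDecay, Theorem p. 573 (1.11)–(1.12), case A = 0 — kernel refutation (node 17) of the verbatim carrier's unguarded SITE-difference reading of `D^η_{A,μ}δG` at the face of Ω, for 0 < α < 1; the print's `D^η_{A,μ}` is a bond derivative; NOT a claim against the printed Theorem] -/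
theorem not_ofPrintedAllXPN_withZeroFieldFamE_b4 (X : PrintedCarriersR) (Y : PrintedCarriers9X)
    (Z : PrintedCarriers11) (V : PrintedCarriers14R) (W : PrintedCarriers15) {d : ℕ} {a : ℝ} (ha : 0 < a)
    {Mb : ℕ} (hMb : 1 ≤ Mb) {g : ∀ i : B4Cor23ZeroEta.ZeroFieldInstance d, (↥i.R → ℝ) → ℝ}
    (hg : ∀ i f, 0 ≤ g i f) :
    ¬ (Upstream.ofPrintedAllXPN (X.withZeroFieldFamE d a Mb g) Y Z V W).b4 := by
  rw [ofPrintedAllXPN_withZeroFieldFamE_b4_eq]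
  exact not_b4LeafNN_zeroFieldSettingB ha hMb hg X.famU X.famF X.d4 X.N4

/-- Binding carriers whose B4 η-family IS the zero-field nested-box family in b04's VERBATIM carrier `nestFamB`
(index type `B4Ineq111ZeroNestEta.NestInst d ℓ m²₊`; every other carrier unchanged) — the site-convention twin of
v4's `withNestFamE`. [folklore] -/
noncomputable def _root_.Literature.MathematicalPhysics.QuantumFieldTheory.Balaban1983to89.DagBinding.PrintedCarriersR.withNestFamBE
    (X : PrintedCarriersR) (d ℓ : ℕ) (m2plus a : ℝ) (Mb : ℕ)
    (g : ∀ i : B4Cor23ZeroEta.ZeroFieldInstance d, (↥i.R → ℝ) → ℝ) : PrintedCarriersR :=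
  { X with I4E := B4Ineq111ZeroNestEta.NestInst d ℓ m2plus,
           famE := B4Ineq111ZeroNestEta.nestFamB ℓ m2plus a Mb g }

/-- The `b4` field of the N-binding over `withNestFamBE` carriers IS the NN leaf with that η-family (`rfl`).
[folklore] -/
theorem ofPrintedAllXPN_withNestFamBE_b4_eq (X : PrintedCarriersR) (Y : PrintedCarriers9X) (Z : PrintedCarriers11)
    (V : PrintedCarriers14R) (W : PrintedCarriers15) (d ℓ : ℕ) (m2plus a : ℝ) (Mb : ℕ)
    (g : ∀ i : B4Cor23ZeroEta.ZeroFieldInstance d, (↥i.R → ℝ) → ℝ) :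
    (Upstream.ofPrintedAllXPN (X.withNestFamBE d ℓ m2plus a Mb g) Y Z V W).b4 =
      B4LeafNN (B4Ineq111ZeroNestEta.nestFamB (d := d) ℓ m2plus a Mb g) X.famU X.famF X.d4 X.N4 :=
  rfl

/-- The `b4` field of the P-binding over `withNestFamBE` carriers IS the TYPED leaf with that η-family (`rfl`).
[folklore] -/
theorem ofPrintedAllXP_withNestFamBE_b4_eq (X : PrintedCarriersR) (Y : PrintedCarriers9X) (Z : PrintedCarriers11)
    (V : PrintedCarriers14R) (W : PrintedCarriers15) (d ℓ : ℕ) (m2plus a : ℝ) (Mb : ℕ)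
    (g : ∀ i : B4Cor23ZeroEta.ZeroFieldInstance d, (↥i.R → ℝ) → ℝ) :
    (Upstream.ofPrintedAllXP (X.withNestFamBE d ℓ m2plus a Mb g) Y Z V W).b4 =
      B4.LeafB4 (B4Ineq111ZeroNestEta.nestFamB (d := d) ℓ m2plus a Mb g) X.famU X.famF X.d4 X.N4 :=
  rfl

/-- **The NN `b4` leaf of the N-binding is FALSE over `withNestFamBE` carriers** (`L ≥ 2`, `[0, m²₊]`, `a > 0`,
`Mb ≥ 1`, `g ≥ 0`). [cite: Balaban1983RegularityDecay, Theorem p. 573 (1.11)–(1.12), case A = 0 — kernel refutation (node 17) of the verbatim carrier's unguarded SITE-difference reading at the face of Ω, for 0 < α < 1; NOT a claim against the printed Theorem] -/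
theorem not_ofPrintedAllXPN_withNestFamBE_b4 (X : PrintedCarriersR) (Y : PrintedCarriers9X)
    (Z : PrintedCarriers11) (V : PrintedCarriers14R) (W : PrintedCarriers15) {d ℓ : ℕ} {m2plus : ℝ}
    (hℓ : 1 ≤ ℓ) (hm2 : 0 ≤ m2plus) {a : ℝ} (ha : 0 < a) {Mb : ℕ} (hMb : 1 ≤ Mb)
    {g : ∀ i : B4Cor23ZeroEta.ZeroFieldInstance d, (↥i.R → ℝ) → ℝ} (hg : ∀ i f, 0 ≤ g i f) :
    ¬ (Upstream.ofPrintedAllXPN (X.withNestFamBE d ℓ m2plus a Mb g) Y Z V W).b4 := by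
  rw [ofPrintedAllXPN_withNestFamBE_b4_eq]
  exact not_b4LeafNN_nestFamB hℓ hm2 ha hMb hg X.famU X.famF X.d4 X.N4

/-- … and so is the TYPED `b4` leaf of the P-binding there. [folklore] -/
theorem not_ofPrintedAllXP_withNestFamBE_b4 (X : PrintedCarriersR) (Y : PrintedCarriers9X)
    (Z : PrintedCarriers11) (V : PrintedCarriers14R) (W : PrintedCarriers15) {d ℓ : ℕ} {m2plus : ℝ}
    (hℓ : 1 ≤ ℓ) (hm2 : 0 ≤ m2plus) {a : ℝ} (ha : 0 < a) {Mb : ℕ} (hMb : 1 ≤ Mb)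
    {g : ∀ i : B4Cor23ZeroEta.ZeroFieldInstance d, (↥i.R → ℝ) → ℝ} (hg : ∀ i f, 0 ≤ g i f) :
    ¬ (Upstream.ofPrintedAllXP (X.withNestFamBE d ℓ m2plus a Mb g) Y Z V W).b4 := by
  rw [ofPrintedAllXP_withNestFamBE_b4_eq]
  exact not_leafB4_nestFamB hℓ hm2 ha hMb hg X.famU X.famF X.d4 X.N4

/-! ### The carrier dichotomy for the NN `b4` leaf on the nested-box family: bond convention ✓ (node 13, v4), verbatim convention ✗ (node 17) -/

/-- **THE CONVENTION DICHOTOMY AT LEAF LEVEL, with the default boundary assignment `g = dist_η(supp f, Ω₀∖Ω)`**: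
over the SAME nested-box instances the NN leaf with node 12's bond-convention carrier is EQUIVALENT to the two
quoted statements «Prop. 2.3 of [1]» ∧ «Prop. 3.1′ of [2]» (conjunct 1 = node 13's `thmPrintedNN_nestFam` with
`bdist_admissible`, conjunct 4 = `B4Sect5Proof.sect5ThmUniform_holds`), while with b04's verbatim carrier it is FALSE
(node 17's `convention_dichotomy`, second half) — the two carriers differ only in the unguarded Hölder fields at
points whose forward bond leaves `Ω`. [cite: Balaban1983RegularityDecay, Theorem p. 573 (1.9)–(1.12), case A = 0 on nested boxes, 0 ≤ α < 1: proved for the bond-convention transcription (node 13), refuted for the site-difference transcription (node 17); Props. 2.3 ∕ 3.1′ p. 574 (quoted); Sect. 5 Theorem p. 594 (proved)] -/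
theorem b4LeafNN_convention_dichotomy {d ℓ : ℕ} {m2plus : ℝ} (hℓ : 1 ≤ ℓ) (hm2 : 0 ≤ m2plus) {a : ℝ}
    (ha : 0 < a) {Mb : ℕ} (hMb : 1 ≤ Mb) {I₂ I₃ : Type} (famU : I₂ → B4.UnitSetting)
    (famF : I₃ → B4.FormSetting) (d₄ N₄ : ℕ) :
    (B4LeafNN (B4Ineq111ZeroNestEta.nestFam (d := d) ℓ m2plus a Mb fun i f =>
          B4Cor23ZeroDelta.bdist i.n i.hsub f) famU famF d₄ N₄ ↔
        B4.Prop23Printed famU ∧ B4.Prop31Printed famF) ∧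
      ¬ B4LeafNN (B4Ineq111ZeroNestEta.nestFamB (d := d) ℓ m2plus a Mb fun i f =>
          B4Cor23ZeroDelta.bdist i.n i.hsub f) famU famF d₄ N₄ :=
  ⟨⟨fun h => ⟨h.2.1, h.2.2.1⟩, fun h =>
      ⟨(B4Ineq112ZeroNestNegFace.convention_dichotomy (m2plus := m2plus) hℓ hm2 ha hMb).1, h.1, h.2,
        B4Sect5Proof.sect5ThmUniform_holds d₄ N₄⟩⟩,
    fun h => (B4Ineq112ZeroNestNegFace.convention_dichotomy (m2plus := m2plus) hℓ hm2 ha hMb).2 h.1⟩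

/-- **THE SAME DICHOTOMY AT BINDING LEVEL**: over one carrier record `X` re-read with the two nested-box η-families,
the NN `b4` leaf of the N-binding is EQUIVALENT to the two quoted Propositions with the bond-convention family
(v4's `withNestFamE`, default boundary assignment) and FALSE with the verbatim family (`withNestFamBE`, any `g ≥ 0`).
[folklore] -/
theorem b4N_bindings_bond_iff_site_false (X : PrintedCarriersR) (Y : PrintedCarriers9X) (Z : PrintedCarriers11)
    (V : PrintedCarriers14R) (W : PrintedCarriers15) {d ℓ : ℕ} {m2plus : ℝ} (hℓ : 1 ≤ ℓ) (hm2 : 0 ≤ m2plus)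
    {a : ℝ} (ha : 0 < a) {Mb : ℕ} (hMb : 1 ≤ Mb)
    {g : ∀ i : B4Cor23ZeroEta.ZeroFieldInstance d, (↥i.R → ℝ) → ℝ} (hg : ∀ i f, 0 ≤ g i f) :
    ((Upstream.ofPrintedAllXPN (X.withNestFamE d ℓ m2plus a Mb) Y Z V W).b4 ↔
        B4.Prop23Printed X.famU ∧ B4.Prop31Printed X.famF) ∧
      ¬ (Upstream.ofPrintedAllXPN (X.withNestFamBE d ℓ m2plus a Mb g) Y Z V W).b4 :=
  ⟨ofPrintedAllXPN_withNestFamE_b4_iff X Y Z V W d ℓ hℓ m2plus ha Mb,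
    not_ofPrintedAllXPN_withNestFamBE_b4 X Y Z V W hℓ hm2 ha hMb hg⟩

/-- NET LEDGER for node `b4`, conjunct 1, after v5 — THREE kernel facts side by side, nothing printed asserted: the
TYPED conjunct (literal «∀ α < 1») is refuted for `α < 0` on b04's zero-field box family (node 16); its `0 ≤ α`
restriction `ThmPrintedNN` is refuted on b04's VERBATIM carriers (site difference at the face; node 17) and is a
THEOREM on node 12's BOND-convention carrier over the zero-field nested boxes (node 13).  What remains bound and
undischarged is `ThmPrintedNN` for `A ≠ 0`, and for any carrier b04 may re-type with a bond guard on `dlhs19`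
(quoted, not claimed). [cite: Balaban1983RegularityDecay, Theorem p. 573 (1.9)–(1.12), case A = 0: typed transcription refuted for α < 0 (node 16); 0 ≤ α restriction refuted for the site-difference carrier (node 17), proved for the bond-convention carrier on nested boxes (node 13)] -/
theorem b4_conj1_ledger_v5 {d ℓ : ℕ} {m2plus : ℝ} (hℓ : 1 ≤ ℓ) (hm2 : 0 ≤ m2plus) {a : ℝ} (ha : 0 < a)
    {Mb : ℕ} (hMb : 1 ≤ Mb) {g : ∀ i : B4Cor23ZeroEta.ZeroFieldInstance d, (↥i.R → ℝ) → ℝ}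
    (hg : ∀ i f, 0 ≤ g i f) :
    (¬ B4.ThmPrinted (B4Ineq19ZeroBoxEta.boxFamB ℓ m2plus a Mb g)) ∧
      (¬ B4Ineq111ZeroNestEta.ThmPrintedNN
          (B4Cor23ZeroEta.zeroFieldSettingB a Mb g : B4Cor23ZeroEta.ZeroFieldInstance d → B4.EtaSetting)) ∧
      (¬ B4Ineq111ZeroNestEta.ThmPrintedNN (B4Ineq111ZeroNestEta.nestFamB (d := d) ℓ m2plus a Mb g)) ∧
      B4Ineq111ZeroNestEta.ThmPrintedNN (fun i : B4Ineq111ZeroNestEta.NestInst d ℓ m2plus =>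
        B4Ineq19ZeroBoxEta.zeroFieldSettingBondStd a Mb i.toZF) :=
  ⟨B4Thm19ZeroBoxNegAlpha.not_thmPrinted_boxFamB hℓ hm2 ha hMb g,
    B4Ineq112ZeroNestNegFace.not_thmPrintedNN_zeroFieldSettingB ha hMb hg,
    B4Ineq112ZeroNestNegFace.not_thmPrintedNN_nestFamB hℓ hm2 ha hMb hg,
    B4Ineq111ZeroNestEta.thmPrintedNN_nestFam_std hℓ a ha Mb⟩

/-! ### Non-vacuity: the physical instance `d + 1 = 4`, `L = 2`, `a = 1`, unit big blocks, `g = 0` -/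

/-- over b04's default carrier on all four-dimensional zero-field instances the NN leaf fails, whatever the other
families. -/
example {I₂ I₃ : Type} (famU : I₂ → B4.UnitSetting) (famF : I₃ → B4.FormSetting) (d₄ N₄ : ℕ) :
    ¬ B4LeafNN (B4Cor23ZeroEta.zeroFieldSetting 1 1 : B4Cor23ZeroEta.ZeroFieldInstance 3 → B4.EtaSetting)
        famU famF d₄ N₄ :=
  not_b4LeafNN_zeroFieldSetting one_pos le_rfl famU famF d₄ N₄

/-- the binding-level dichotomy, instantiated. -/
example (X : PrintedCarriersR) (Y : PrintedCarriers9X) (Z : PrintedCarriers11) (V : PrintedCarriers14R)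
    (W : PrintedCarriers15) :
    ((Upstream.ofPrintedAllXPN (X.withNestFamE 3 1 0 1 1) Y Z V W).b4 ↔
        B4.Prop23Printed X.famU ∧ B4.Prop31Printed X.famF) ∧
      ¬ (Upstream.ofPrintedAllXPN (X.withNestFamBE 3 1 0 1 1 fun _ _ => 0) Y Z V W).b4 :=
  b4N_bindings_bond_iff_site_false X Y Z V W le_rfl le_rfl one_pos le_rfl fun _ _ => le_rfl

end LeafB4NNNegFace

/-! ## Leaf `b4`, conjunct 1 — the REFEREE's RULING G-ref1-32 («B4-RETYPE: yes», cell journal 2026-08-19 20:40:30Z): the FAITHFUL reading of «Theorem p. 573 (1.8)–(1.12)» is node 13's `ThmPrintedNN` (`0 ≤ α < 1`) on node 12's BOND-guarded carriers; the NN leaf re-pointed BY NAME for every admissible boundary assignment (v6) -/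

section LeafB4Conj1Ruled

/-! ### Leaf level: the NN leaf over the bond-guarded nested-box family, general admissible `g` -/

/-- **THE NN LEAF IN THE RULED READING IS DISCHARGED ON THE BOND-GUARDED ZERO-FIELD NESTED BOXES FOR EVERY ADMISSIBLE
BOUNDARY ASSIGNMENT**: for `L = ℓ + 1 ≥ 2`, `a > 0`, any `m²₊`, `Mb` and any `g` with `g i f ≤ dist_η(supp f, Ω₀∖Ω)`
whenever both sets are non-empty, the NN leaf `B4LeafNN` over node 13's family `nestFam ℓ m²₊ a Mb g` (node 12's
bond-guarded carrier `zeroFieldSettingBond a Mb g` of each member's instance, `B4Ineq111ZeroNestEta.nestFam_eq`) is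
EQUIVALENT to the two QUOTED statements «Prop. 2.3 of [1]» ∧ «Prop. 3.1′ of [2]»: conjunct 1 is node 13's
`thmPrintedNN_nestFam` and conjunct 4 is `B4Sect5Proof.sect5ThmUniform_holds`, both BY NAME.  By the cell referee's
ruling G-ref1-32 this conjunct 1 — `ThmPrintedNN` (`0 ≤ α < 1`) on the bond-guarded carrier — is the FAITHFUL reading
of the printed Theorem at `A = 0` on these regions. [cite: Balaban1983RegularityDecay, Theorem p. 573 (1.8)–(1.12), case A = 0, Ω ⊂ Ω₀ nested boxes, 0 ≤ α < 1, bond-guarded Hölder carrier (the reading ruled faithful by the cell referee, G-ref1-32) — proved (node 13); Props. 2.3 ∕ 3.1′ p. 574 (quoted); Sect. 5 Theorem p. 594 (proved)] -/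
theorem b4LeafNN_nestFam_iff {d ℓ : ℕ} {m2plus : ℝ} (hℓ : 1 ≤ ℓ) {a : ℝ} (ha : 0 < a) (Mb : ℕ)
    {g : ∀ i : B4Cor23ZeroEta.ZeroFieldInstance d, (↥i.R → ℝ) → ℝ}
    (hg : ∀ (i : B4Cor23ZeroEta.ZeroFieldInstance d) (f : ↥i.R → ℝ),
      (B4Cor23ZeroDelta.outR i.R i.R₀).Nonempty → (B4Cor23Zero.supp f).Nonempty →
        g i f ≤ B4Cor23ZeroDelta.bdist i.n i.hsub f)
    {I₂ I₃ : Type} (famU : I₂ → B4.UnitSetting) (famF : I₃ → B4.FormSetting) (d₄ N₄ : ℕ) :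
    B4LeafNN (B4Ineq111ZeroNestEta.nestFam (d := d) ℓ m2plus a Mb g) famU famF d₄ N₄ ↔
      B4.Prop23Printed famU ∧ B4.Prop31Printed famF :=
  ⟨fun h => ⟨h.2.1, h.2.2.1⟩, fun h =>
    ⟨B4Ineq111ZeroNestEta.thmPrintedNN_nestFam (m2plus := m2plus) hℓ a ha Mb hg, h.1, h.2,
      B4Sect5Proof.sect5ThmUniform_holds d₄ N₄⟩⟩

/-- hence, given the two quoted Propositions over the other carriers, the NN leaf HOLDS over the bond-guarded nested
boxes for every admissible `g`. [cite: Balaban1983RegularityDecay, Theorem p. 573 (1.8)–(1.12), case A = 0, nested boxes, 0 ≤ α < 1, bond-guarded carrier — proved (node 13); Props. 2.3 ∕ 3.1′ p. 574 quoted as hypotheses] -/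
theorem b4LeafNN_nestFam_of_quoted {d ℓ : ℕ} {m2plus : ℝ} (hℓ : 1 ≤ ℓ) {a : ℝ} (ha : 0 < a) (Mb : ℕ)
    {g : ∀ i : B4Cor23ZeroEta.ZeroFieldInstance d, (↥i.R → ℝ) → ℝ}
    (hg : ∀ (i : B4Cor23ZeroEta.ZeroFieldInstance d) (f : ↥i.R → ℝ),
      (B4Cor23ZeroDelta.outR i.R i.R₀).Nonempty → (B4Cor23Zero.supp f).Nonempty →
        g i f ≤ B4Cor23ZeroDelta.bdist i.n i.hsub f)
    {I₂ I₃ : Type} {famU : I₂ → B4.UnitSetting} {famF : I₃ → B4.FormSetting} (h₂ : B4.Prop23Printed famU)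
    (h₃ : B4.Prop31Printed famF) (d₄ N₄ : ℕ) :
    B4LeafNN (B4Ineq111ZeroNestEta.nestFam (d := d) ℓ m2plus a Mb g) famU famF d₄ N₄ :=
  (b4LeafNN_nestFam_iff hℓ ha Mb hg famU famF d₄ N₄).2 ⟨h₂, h₃⟩

/-- **NON-VACUITY OF THE DISCHARGE**: at every scale `k ≥ 1` and every charge bound `e₁ > 0` some member of the
bond-guarded nested-box family meets all four antecedents of the typed Hölder clause (regular, big blocks,
`0 < e ≤ e₁`) — node 13's `threshold_met` BY NAME (`m²₊ ≥ 0`, `Mb ≥ 1`). [cite: Balaban1983RegularityDecay, Theorem p. 573, hypotheses (regularity (1.7) trivial at A = 0, big blocks, small e) met on the nested boxes — kernel fact of node 13] -/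
theorem b4_conj1_ruled_nonvacuous {d ℓ : ℕ} {m2plus : ℝ} (hm2 : 0 ≤ m2plus) (a : ℝ)
    (g : ∀ i : B4Cor23ZeroEta.ZeroFieldInstance d, (↥i.R → ℝ) → ℝ) {Mb : ℕ} (hMb : 1 ≤ Mb) (k : ℕ)
    (hk : 1 ≤ k) {e₁ : ℝ} (he : 0 < e₁) :
    ∃ i : B4Ineq111ZeroNestEta.NestInst d ℓ m2plus, i.k = k ∧
      (B4Ineq111ZeroNestEta.nestFam ℓ m2plus a Mb g i).regular ∧
      (B4Ineq111ZeroNestEta.nestFam ℓ m2plus a Mb g i).bigBlocks ∧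
      0 < (B4Ineq111ZeroNestEta.nestFam ℓ m2plus a Mb g i).e ∧
      (B4Ineq111ZeroNestEta.nestFam ℓ m2plus a Mb g i).e ≤ e₁ :=
  B4Ineq111ZeroNestEta.threshold_met hm2 a g hMb k hk he

/-! ### Binding level: carriers whose B4 η-family IS the bond-guarded nested-box family with a general boundary assignment -/

/-- Binding carriers whose B4 η-family (the carriers of Theorem p. 573) IS node 13's bond-guarded zero-field nested-box
family `nestFam ℓ m²₊ a Mb g` with a GENERAL boundary assignment `g` (index type `NestInst d ℓ m²₊`; every other
carrier unchanged) — v4's `withNestFamE` is the instance `zeroFieldSettingBondStd`, v5's `withNestFamBE` the verbatim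
(unguarded) sibling. [folklore] -/
noncomputable def _root_.Literature.MathematicalPhysics.QuantumFieldTheory.Balaban1983to89.DagBinding.PrintedCarriersR.withNestFamGE
    (X : PrintedCarriersR) (d ℓ : ℕ) (m2plus a : ℝ) (Mb : ℕ)
    (g : ∀ i : B4Cor23ZeroEta.ZeroFieldInstance d, (↥i.R → ℝ) → ℝ) : PrintedCarriersR :=
  { X with I4E := B4Ineq111ZeroNestEta.NestInst d ℓ m2plus,
           famE := B4Ineq111ZeroNestEta.nestFam ℓ m2plus a Mb g }

/-- The `b4` field of the N-binding over `withNestFamGE` carriers IS the NN leaf with that η-family (`rfl`): the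
binding of the carriers of Theorem p. 573 unfolded. [cite: Balaban1983RegularityDecay, Theorem p. 573 (1.8)–(1.12) — the typed binding of its carriers to the bond-guarded zero-field nested-box family, definitional unfolding only; nothing printed asserted] -/
theorem ofPrintedAllXPN_withNestFamGE_b4_eq (X : PrintedCarriersR) (Y : PrintedCarriers9X) (Z : PrintedCarriers11)
    (V : PrintedCarriers14R) (W : PrintedCarriers15) (d ℓ : ℕ) (m2plus a : ℝ) (Mb : ℕ)
    (g : ∀ i : B4Cor23ZeroEta.ZeroFieldInstance d, (↥i.R → ℝ) → ℝ) :
    (Upstream.ofPrintedAllXPN (X.withNestFamGE d ℓ m2plus a Mb g) Y Z V W).b4 =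
      B4LeafNN (B4Ineq111ZeroNestEta.nestFam (d := d) ℓ m2plus a Mb g) X.famU X.famF X.d4 X.N4 :=
  rfl

/-- **Leaf `b4` of the N-binding over `withNestFamGE` carriers, for every admissible `g`, is EQUIVALENT to the two
QUOTED statements «Prop. 2.3 of [1]» ∧ «Prop. 3.1′ of [2]»** (over the carriers' own `famU`, `famF`): conjuncts 1
(ruled reading) and 4 DISCHARGED by name. [cite: Balaban1983RegularityDecay, Theorem p. 573 (1.8)–(1.12), case A = 0, nested boxes, 0 ≤ α < 1, bond-guarded carrier — proved (node 13); Props. 2.3 ∕ 3.1′ p. 574 (quoted); Sect. 5 Theorem p. 594 (proved)] -/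
theorem ofPrintedAllXPN_withNestFamGE_b4_iff (X : PrintedCarriersR) (Y : PrintedCarriers9X) (Z : PrintedCarriers11)
    (V : PrintedCarriers14R) (W : PrintedCarriers15) {d ℓ : ℕ} (hℓ : 1 ≤ ℓ) (m2plus : ℝ) {a : ℝ} (ha : 0 < a)
    (Mb : ℕ) {g : ∀ i : B4Cor23ZeroEta.ZeroFieldInstance d, (↥i.R → ℝ) → ℝ}
    (hg : ∀ (i : B4Cor23ZeroEta.ZeroFieldInstance d) (f : ↥i.R → ℝ),
      (B4Cor23ZeroDelta.outR i.R i.R₀).Nonempty → (B4Cor23Zero.supp f).Nonempty →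
        g i f ≤ B4Cor23ZeroDelta.bdist i.n i.hsub f) :
    (Upstream.ofPrintedAllXPN (X.withNestFamGE d ℓ m2plus a Mb g) Y Z V W).b4 ↔
      B4.Prop23Printed X.famU ∧ B4.Prop31Printed X.famF := by
  rw [ofPrintedAllXPN_withNestFamGE_b4_eq]
  exact b4LeafNN_nestFam_iff (m2plus := m2plus) hℓ ha Mb hg X.famU X.famF X.d4 X.N4

/-- **THE TWO SIBLING BINDINGS SIDE BY SIDE, same admissible `g ≥ 0`**: over `withNestFamGE` (bond guard — the ruled
reading) the NN `b4` leaf ↔ the two quoted Propositions; over v5's `withNestFamBE` (verbatim site difference — a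
transcription defect by G-ref1-32) it is FALSE. [cite: Balaban1983RegularityDecay, Theorem p. 573 (1.8)–(1.12), case A = 0, nested boxes: bond-guarded reading proved (node 13), verbatim site-difference transcription refuted (node 17); the referee's ruling G-ref1-32 classifies the latter as a transcription defect] -/
theorem b4N_bindings_ruled_iff_verbatim_false (X : PrintedCarriersR) (Y : PrintedCarriers9X)
    (Z : PrintedCarriers11) (V : PrintedCarriers14R) (W : PrintedCarriers15) {d ℓ : ℕ} {m2plus : ℝ}
    (hℓ : 1 ≤ ℓ) (hm2 : 0 ≤ m2plus) {a : ℝ} (ha : 0 < a) {Mb : ℕ} (hMb : 1 ≤ Mb)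
    {g : ∀ i : B4Cor23ZeroEta.ZeroFieldInstance d, (↥i.R → ℝ) → ℝ} (hg0 : ∀ i f, 0 ≤ g i f)
    (hg : ∀ (i : B4Cor23ZeroEta.ZeroFieldInstance d) (f : ↥i.R → ℝ),
      (B4Cor23ZeroDelta.outR i.R i.R₀).Nonempty → (B4Cor23Zero.supp f).Nonempty →
        g i f ≤ B4Cor23ZeroDelta.bdist i.n i.hsub f) :
    ((Upstream.ofPrintedAllXPN (X.withNestFamGE d ℓ m2plus a Mb g) Y Z V W).b4 ↔
        B4.Prop23Printed X.famU ∧ B4.Prop31Printed X.famF) ∧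
      ¬ (Upstream.ofPrintedAllXPN (X.withNestFamBE d ℓ m2plus a Mb g) Y Z V W).b4 :=
  ⟨ofPrintedAllXPN_withNestFamGE_b4_iff X Y Z V W hℓ m2plus ha Mb hg,
    not_ofPrintedAllXPN_withNestFamBE_b4 X Y Z V W hℓ hm2 ha hMb hg0⟩

/-! ### The net ledger for conjunct 1 after the ruling -/

/-- **NET LEDGER for node `b4`, conjunct 1, after v6** — three kernel facts for ONE AND THE SAME admissible boundary
assignment `g ≥ 0` on the zero-field nested boxes (`L ≥ 2`, `m²₊ ≥ 0`, `a > 0`, `Mb ≥ 1`), nothing printed asserted: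
the RULED faithful reading (bond-guarded carrier, `0 ≤ α < 1`; G-ref1-32) is a THEOREM there (node 13); the `0 ≤ α`
reading on b04's VERBATIM site-difference carrier is REFUTED there (node 17); the literal-range typed conjunct
`B4.ThmPrinted` («∀ α < 1») is REFUTED on the boxes (node 16) — the last two being, by the ruling, defects of the
transcription and not readings of the print.  What remains QUOTED and undischarged is the ruled reading for `A ≠ 0`
and, at `A = 0`, for general big-block unions `Ω ⊂ Ω₀` other than nested boxes (cell GAPS C-carver-g14-2). [cite: Balaban1983RegularityDecay, Theorem p. 573 (1.8)–(1.12), case A = 0 on nested boxes: ruled bond-guarded reading with 0 ≤ α < 1 proved (node 13); verbatim site-difference transcription refuted (node 17); literal range «α < 1» refuted for α < 0 (node 16) — classification of the two refuted readings as transcription defects by the cell referee's ruling G-ref1-32] -/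
theorem b4_conj1_ledger_v6 {d ℓ : ℕ} {m2plus : ℝ} (hℓ : 1 ≤ ℓ) (hm2 : 0 ≤ m2plus) {a : ℝ} (ha : 0 < a)
    {Mb : ℕ} (hMb : 1 ≤ Mb) {g : ∀ i : B4Cor23ZeroEta.ZeroFieldInstance d, (↥i.R → ℝ) → ℝ}
    (hg0 : ∀ i f, 0 ≤ g i f)
    (hg : ∀ (i : B4Cor23ZeroEta.ZeroFieldInstance d) (f : ↥i.R → ℝ),
      (B4Cor23ZeroDelta.outR i.R i.R₀).Nonempty → (B4Cor23Zero.supp f).Nonempty →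
        g i f ≤ B4Cor23ZeroDelta.bdist i.n i.hsub f) :
    B4Ineq111ZeroNestEta.ThmPrintedNN (B4Ineq111ZeroNestEta.nestFam (d := d) ℓ m2plus a Mb g) ∧
      (¬ B4Ineq111ZeroNestEta.ThmPrintedNN (B4Ineq111ZeroNestEta.nestFamB (d := d) ℓ m2plus a Mb g)) ∧
      ¬ B4.ThmPrinted (B4Ineq19ZeroBoxEta.boxFamB ℓ m2plus a Mb g) :=
  ⟨B4Ineq111ZeroNestEta.thmPrintedNN_nestFam (m2plus := m2plus) hℓ a ha Mb hg,
    B4Ineq112ZeroNestNegFace.not_thmPrintedNN_nestFamB hℓ hm2 ha hMb hg0,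
    B4Thm19ZeroBoxNegAlpha.not_thmPrinted_boxFamB hℓ hm2 ha hMb g⟩

/-! ### Non-vacuity: the physical instance `d + 1 = 4`, `L = 2`, `a = 1`, `m²₊ = 0`, unit big blocks, default boundary assignment -/

/-- over the bond-guarded four-dimensional nested boxes with `g = dist_η(supp f, Ω₀∖Ω)` the NN leaf ↔ the two quoted
Propositions. -/
example {I₂ I₃ : Type} (famU : I₂ → B4.UnitSetting) (famF : I₃ → B4.FormSetting) (d₄ N₄ : ℕ) :
    B4LeafNN (B4Ineq111ZeroNestEta.nestFam (d := 3) 1 0 1 1 fun i f => B4Cor23ZeroDelta.bdist i.n i.hsub f)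
        famU famF d₄ N₄ ↔ B4.Prop23Printed famU ∧ B4.Prop31Printed famF :=
  b4LeafNN_nestFam_iff le_rfl one_pos 1 B4Ineq111ZeroNestEta.bdist_admissible famU famF d₄ N₄

/-- … and the three-fact ledger is inhabited there. -/
example :
    B4Ineq111ZeroNestEta.ThmPrintedNN
        (B4Ineq111ZeroNestEta.nestFam (d := 3) 1 0 1 1 fun i f => B4Cor23ZeroDelta.bdist i.n i.hsub f) ∧
      (¬ B4Ineq111ZeroNestEta.ThmPrintedNN
        (B4Ineq111ZeroNestEta.nestFamB (d := 3) 1 0 1 1 fun i f => B4Cor23ZeroDelta.bdist i.n i.hsub f)) ∧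
      ¬ B4.ThmPrinted (B4Ineq19ZeroBoxEta.boxFamB (d := 3) 1 0 1 1 fun i f => B4Cor23ZeroDelta.bdist i.n i.hsub f) :=
  b4_conj1_ledger_v6 le_rfl le_rfl one_pos le_rfl (fun i f => B4Ineq112ZeroNestNegFace.bdist_nonneg i f)
    B4Ineq111ZeroNestEta.bdist_admissible

end LeafB4Conj1Ruled

end Literature.MathematicalPhysics.QuantumFieldTheory.Balaban1983to89.DagDischargedII
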